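import Literature.AlgebraicGeometry.Resolution.WeightedCentreVertexPreparation
import Literature.AlgebraicGeometry.Resolution.WeightedCentreVertexPreparationNormalised
import HarnessLib

/-!
# The count on the `δ`-face by exhaustion of twists: every competitor centre solves the vertex

Companion to `WeightedCentreVertexPreparation.lean` (§9 there) and
`WeightedCentreVertexPreparationNormalised.lean`, kept in a separate file only because the parent file
sits at the 200 000-byte cap; the four private helper lemmas of the parent that the proofs need
(`blockDeg_eq_sum_univ`, `blockDeg_eq_zero_iff`, `coeff_sum_filter_monomial`, `exists_eq_mul_den`) are
DUPLICATED here verbatim (private, `[folklore]`); nothing in the parent file is changed.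

[CJS20] Cossart–Jannsen–Saito, *Desingularization: Invariants and Strategy*, LNM 2270 (2020):
Def. 8.2 (4) (p. 118: `in_δ`, the `δ`-face = `in_v(f)` at the vertex `v`, `|v| = δ`), Def. 8.13
(pp. 120–121: "`(f, y, u)` is solvable at `v` if there are `λ_1, …, λ_r ∈ k[U]` … `in_v(f)_i =
F_i(Y + λ)`"; the `y`-translations `Y ↦ Y + λ(U)`), Thm. 8.16 (p. 121; = [H3] Hironaka, *Characteristic
polyhedra of singularities*, J. Math. Kyoto Univ. 7 (1967), Thm. (4.8): prepared = not solvable, and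
prepared vertices persist), Thm. 8.22 (a) (p. 124: "Any solution for `(f, y, u)` at `v` is of the form
`λ` with `λ_i = c_i U^v`" — solutions are HOMOGENEOUS of degree `|v| = δ` in `U`); [CoP08]
Cossart–Piltant, J. Algebra 320 (2008), proof of Prop. 4.2 (the directrix as the space of linear forms
vanishing on the translation-invariance space `𝕎`, `τ = dim`); [ATW24] Abramovich–Temkin–Włodarczyk,
Algebra & Number Theory 18 (2024), Thm. 5.3.1 (p. 1578) and its proof (2)–(3) (the invariant is
independent of the coordinates; the Jacobian blocks of a graded coordinate change are invertible,
Lemma 5.2.10 (p. 1577)); [AQS25] Abramovich–Quek–Schober, Thm. 3.5.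

POLYNOMIAL MODEL and notation exactly as in the parent file: `ν = ord f`, `in_ν f ∈ k[X_S]`,
`|S| = τ(in_ν f)`, `(y, u) = (X_S, X_{Sᶜ})`, `δ = δ(f; u; y)` (`hironakaDelta`), `(f; y; u)`
`δ`-prepared (`IsDeltaPrepared`), a centre `(Ψ; γ)` for `f` (`IsCentreFor`: `Ψ(0) = 0`, `γ ≥ 0`,
`Ψ⁻¹ f` admissible for `γ`), the prefix class `γ = 1/ν` on `S`, `γ ≤ 1/(νδ)` off `S`,
`M(γ) = {j ∉ S : γ_j = 1/(νδ)}`, the competitor's forms `T(Ψ, γ) = ⟨X_i (i ∈ S), ℓ_j (j ∈ M(γ))⟩`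
(`competitorSpan`; `ℓ_j` = the `u`-linear part of `z_j = Ψ(X_j)`), `Φ_i = uHomogeneousPart S δ (Ψ (X i))`
(the pure-`u` degree-`δ` part of the `y'`-coordinate `z_i`, `i ∈ S`), `in_δ f` (`deltaInitial`),
`𝕎(·)` (`invarianceSpace`), `τ(·)` (`hironakaTau`).

DEFINED here: `twist S Ξ` — the `y`-translation `X_i ↦ X_i + Ξ_i (i ∈ S)`, `X_j ↦ X_j (j ∉ S)` of
Def. 8.13 as a `k`-algebra endomorphism of `k[X]` (we only ever feed it `Ξ_i ∈ k[U]`), and its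
extension `twistT S Ξ` to `k[X, T]` (the ring of `translate`).

PROVED here — statements and proofs OURS, in the model:
* `exists_twist_deltaInitial_mem_linearFormsSubalgebra` — THE SOLUTION ATTACHED TO A CENTRE. For
  `(f; y; u)` `δ`-prepared and ANY centre `(Ψ; γ)` of the prefix class there is a twist `Ξ = Ξ(Ψ)`,
  `Ξ_i ∈ k[U]` homogeneous of degree `δ` (so `Ξ = 0` when `δ ∉ ℕ`, Thm. 8.22 (a)), with
  `twist_Ξ (in_δ f) ∈ k[T(Ψ, γ)]`; explicitly `Ξ = −A⁻¹ Φ` where `A = (∂z_i/∂X_l(0))_{i,l ∈ S}` is the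
  `y`-block of the Jacobian of `Ψ` (invertible by `sum_jacobianBlock_symm_mul_jacobianBlock`, [ATW24]
  proof of Thm. 5.3.1) and `Φ = (Φ_i)_{i ∈ S}`: reading `in_δ f = (in_w Ψ⁻¹f)(in_w z)` (the parent's
  `deltaInitial_eq_aeval_of_isCentreFor`, `in_w z_i = Σ_{l ∈ S} a_{il} X_l + Φ_i`, `in_w z_j = ℓ_j`)
  through `twist_Ξ` kills every `Φ_i`;
* `exists_twist_hironakaTau_le_of_isCentreFor` — hence THE TWISTED COUNT, unconditional in the
  competitor: `min_Ξ τ(twist_Ξ in_δ f) ≤ |S| + #M(γ)` (some degree-`δ` twist of the `δ`-face has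
  `τ ≤ |S| + #{j ∉ S : γ_j = 1/(νδ)}`);
* `hironakaTau_deltaInitial_le_of_forall_twist` — THE COUNT BY EXHAUSTION OF TWISTS: if no degree-`δ`
  twist hides a `u`-direction that `in_δ f` uses (for every `c` with `c_S = 0` and `c ∉ 𝕎(in_δ f)` and
  every `Ξ ∈ k[U]_δ^S`: `c ∉ 𝕎(twist_Ξ in_δ f)`), then `τ(in_δ f) ≤ |S| + #M(γ)` for EVERY centre of
  the prefix class — the hypothesis replaces the normalisation hypotheses (IND)+(N0) / (IND)+(N0_W)
  of the parent files by a finite check over the twists ((IND)+(N0) implies it —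
  `forall_twist_of_linearIndependent`, rev. 2, §10: the `y`-degree-`(ν−1)` slice of `twist_Ξ in_δ f`
  is `Σ_l Ξ_l ∂_l in_ν f` by the first-order Taylor formula `weightedHomogeneousComponent_twist_eq`
  (the slice of `in_δ f` vanishes by (N0)), its `c`-invariance forces each `Ξ_l` to be `c`-invariant
  (coefficient extraction along `k[T, U]` + (IND)), and Lemma F below concludes; so the parent's
  `hironakaTau_deltaInitial_le_of_linearIndependent` is the case (N0)+(IND) of this count:
  `hironakaTau_deltaInitial_le_of_linearIndependent_of_forall_twist`; for (IND)+(N0_W) (the companion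
  WeightedCentreVertexPreparationNormalised: the slices `N_e` of `N` transversal to `span {∂_l in_ν f}`)
  the slice is `N + Σ_l Ξ_l ∂_l in_ν f` and the same extraction works — `forall_twist_of_disjoint`,
  rev. 3, §11, so that `hironakaTau_deltaInitial_le_of_disjoint` is the case (N0_W)+(IND):
  `hironakaTau_deltaInitial_le_of_disjoint_of_forall_twist`); the inclusion behind it is
  `dualCoannihilator_competitorSpan_le_invarianceSpace_of_forall_twist`, `T(Ψ, γ)^⊥ ⊆ 𝕎(in_δ f)`;
* `directrix_deltaInitial_eq_competitorSpan_of_forall_twist` — THE HAND-OVER: under the same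
  hypothesis a centre attaining the count (`#M(γ) ≤ τ(in_δ f) − |S|`) has
  `T(Ψ, γ) = T(in_δ f)`: its weight-`1/(νδ)` linear parts `ℓ_j` and `X_S` span exactly the directrix
  of the `δ`-face (what the next stage starts from); under (N0)+(IND):
  `directrix_deltaInitial_eq_competitorSpan_of_linearIndependent` (rev. 2); under (N0_W)+(IND):
  `directrix_deltaInitial_eq_competitorSpan_of_disjoint` (rev. 3);
* `mem_invarianceSpace_twist_iff_of_sub_mem` (Lemma F) — for `c` with `c_S = 0`, twists `Ξ, Ξ' ∈ k[U]^S`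
  that differ by `c`-translation-invariant polynomials give `c ∈ 𝕎(twist_Ξ H) ↔ c ∈ 𝕎(twist_{Ξ'} H)`
  (the twists form an abelian group commuting with the translation by `c`), so that in the exhaustion
  only a system of representatives modulo `c`-invariant twists need be checked:
  `forall_twist_of_forall_twist_repr`, `hironakaTau_deltaInitial_le_of_forall_twist_repr`,
  `directrix_deltaInitial_eq_competitorSpan_of_forall_twist_repr`.
Representatives: in `u`-coordinates `R = (R_1, R')` adapted to `c` (`c = e_1`, i.e. the linear forms
`R'` vanish at `c`) split `Ξ = Ξ⁰ + Ξ¹` with `Ξ⁰` free of `R_1` and every monomial of `Ξ¹` divisible by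
`R_1`; `Ξ⁰ ∈ k[R']` is `c`-invariant by `dualCoannihilator_le_invarianceSpace` (HironakaDirectrix), so
the `c`-PURE twists `Ξ¹` represent (so, for a given `f` over a finite field, finitely many systems decide
the hypothesis; the converse,
that `c`-invariant polynomials are `R_1`-free — translation invariance being the identity
`F(U + Tc) = F(U)` in `T`, in every characteristic — is recorded, not formalised, and not needed).
NOT claimed: anything for general ideals (`m > 1`), formal coordinate changes, later stages of the
invariant (twists with lower-order terms), or that the exhaustion hypothesis is necessary for the count.

REV. 2 (2026-08-22, same unit) adds §8–§10 and changes nothing above them: §8 the `y`-slices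
(`weightedHomogeneousComponent` for the indicator weight of `S`) of twisted polynomials — the
first-order Taylor formula `[twist_Ξ P]_m = [P]_m + Σ_{l ∈ S} Ξ_l ∂_l [P]_{m+1}` for `P` of `y`-degree
`≤ m + 1` (induction on monomials) and the commutation of slices with `ι : k[X] → k[X, T]` and with the
translations `translate c`, `c_S = 0` (substitution by weighted-homogeneous polynomials of the matching
weights); §9 a generic copy of the parent's private coefficient extraction `coeffAlong` (any index type,
any decidable set of variables); §10 the bridge `forall_twist_of_linearIndependent` ((N0)+(IND) ⇒ the
exhaustion hypothesis) with the two corollaries named above.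
REV. 3 (2026-08-22, same unit) adds the import of WeightedCentreVertexPreparationNormalised and §11:
`forall_twist_of_disjoint` ((N0_W)+(IND) ⇒ the exhaustion hypothesis, by the same slice argument with the
family `N_e` carried along in the coefficient extraction) and its two corollaries; nothing above §11 changed.
-/

noncomputable section

open MvPolynomial
open Finsupp (weight)

namespace Literature.AlgebraicGeometry.Resolution

namespace WeightedBlowup

variable {k : Type*} [Field k] {n : ℕ}

/-! ## §1 Duplicated private helpers of the parent file -/

section Helpers

variable (S : Finset (Fin n))

/-- `|B| = Σ_{i ∈ S} d i`. [folklore] -/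
private theorem blockDeg_eq_sum_univ (d : Fin n →₀ ℕ) :
    blockDeg S d = ∑ i ∈ S, d i := by
  classical
  rw [blockDeg]
  refine (Finset.sum_subset (fun i hi => (Finset.mem_filter.mp hi).2) fun i hiS hi => ?_).trans rfl
  · simpa [Finset.mem_filter, hiS] using hi

/-- `|B| = 0 ⟺ d` vanishes on `S`. [folklore] -/
private theorem blockDeg_eq_zero_iff (d : Fin n →₀ ℕ) : blockDeg S d = 0 ↔ ∀ i ∈ S, d i = 0 := by
  rw [blockDeg_eq_sum_univ, Finset.sum_eq_zero_iff]

/-- Coefficients of a support-restricted sum of the monomials of `g`. [folklore] -/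
private theorem coeff_sum_filter_monomial (P : (Fin n →₀ ℕ) → Prop) [DecidablePred P]
    (g : MvPolynomial (Fin n) k) (d : Fin n →₀ ℕ) :
    coeff d (∑ e ∈ g.support with P e, monomial e (coeff e g)) = if P d then coeff d g else 0 := by
  classical
  rw [coeff_sum]
  simp_rw [coeff_monomial]
  by_cases hP : P d
  · rw [if_pos hP]
    by_cases hd : d ∈ g.support
    · rw [Finset.sum_eq_single_of_mem d (Finset.mem_filter.mpr ⟨hd, hP⟩)
        (fun e _ hne => if_neg hne), if_pos rfl]
    · rw [notMem_support_iff.mp hd]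
      exact Finset.sum_eq_zero fun e he => by
        rw [ite_eq_right_iff]
        rintro rfl
        exact absurd (Finset.mem_filter.mp he).1 hd
  · rw [if_neg hP]
    exact Finset.sum_eq_zero fun e he => by
      rw [ite_eq_right_iff]
      rintro rfl
      exact absurd (Finset.mem_filter.mp he).2 hP

/-- A positive rational as `p/q` with its canonical numerator and denominator. [folklore] -/
private theorem exists_eq_mul_den {δ : ℚ} (hδ : 0 < δ) : ∃ p q : ℕ, 0 < q ∧ (p : ℚ) = δ * q := by
  obtain ⟨p, hp⟩ := Int.eq_ofNat_of_zero_le (Rat.num_nonneg.mpr hδ.le)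
  refine ⟨p, δ.den, δ.den_pos, ?_⟩
  rw [Rat.mul_den_eq_num δ, hp]
  simp

/-- The coefficients of `Φ = uHomogeneousPart S δ P`. [folklore] -/
private theorem coeff_uHomogeneousPart (δ : ℚ) (P : MvPolynomial (Fin n) k) (d : Fin n →₀ ℕ) :
    coeff d (uHomogeneousPart S δ P) =
      if blockDeg S d = 0 ∧ (d.degree : ℚ) = δ then coeff d P else 0 := by
  rw [uHomogeneousPart, coeff_sum_filter_monomial]

/-- `Φ` is pure-`u` of degree `δ`. [folklore] -/
private theorem mem_support_uHomogeneousPart {δ : ℚ} {P : MvPolynomial (Fin n) k} {d : Fin n →₀ ℕ}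
    (hd : d ∈ (uHomogeneousPart S δ P).support) : blockDeg S d = 0 ∧ (d.degree : ℚ) = δ := by
  by_contra h
  exact (mem_support_iff.mp hd) (by rw [coeff_uHomogeneousPart, if_neg h])

/-- A polynomial all of whose monomials have `y`-degree `0` lies in `k[U] = k[X_j : j ∉ S]`. [folklore] -/
private theorem mem_supported_of_blockDeg {P : MvPolynomial (Fin n) k}
    (hP : ∀ d ∈ P.support, blockDeg S d = 0) : P ∈ supported k {j : Fin n | j ∉ S} := by
  rw [mem_supported]
  intro i hi hiS
  rw [Finset.mem_coe, mem_vars_iff_mem_support] at hi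
  obtain ⟨d, hd, hid⟩ := hi
  exact (Finsupp.mem_support_iff.mp hid) ((blockDeg_eq_zero_iff S d).mp (hP d hd) i hiS)

end Helpers

/-! ## §2 Twists `Y ↦ Y + Ξ(U)` and their commutation with translations -/

section Twist

variable (S : Finset (Fin n))

/-- **The twist `X_i ↦ X_i + Ξ_i (i ∈ S)`, `X_j ↦ X_j (j ∉ S)`** — for `Ξ_i ∈ k[U]` the
`y`-translation `Y ↦ Y + λ(U)` of a candidate solution of a vertex.
[cite: CossartJannsenSaito2020, Def. 8.13 (pp. 120–121), Thm. 8.22 (a) (p. 124)] -/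
def twist (Ξ : Fin n → MvPolynomial (Fin n) k) :
    MvPolynomial (Fin n) k →ₐ[k] MvPolynomial (Fin n) k :=
  aeval fun i => if i ∈ S then X i + Ξ i else X i

variable {S}

/-- `twist_Ξ (X_i) = X_i + Ξ_i` for `i ∈ S` (the translation `Y ↦ Y + λ(U)` on the `y`-variables).
[cite: CossartJannsenSaito2020, Def. 8.13 (pp. 120–121)] -/
@[simp] theorem twist_X_of_mem (Ξ : Fin n → MvPolynomial (Fin n) k) {i : Fin n} (hi : i ∈ S) :
    twist S Ξ (X i) = X i + Ξ i := by
  rw [twist, aeval_X, if_pos hi]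

/-- `twist_Ξ (X_j) = X_j` for `j ∉ S` (the translation `Y ↦ Y + λ(U)` fixes `U`).
[cite: CossartJannsenSaito2020, Def. 8.13 (pp. 120–121)] -/
@[simp] theorem twist_X_of_not_mem (Ξ : Fin n → MvPolynomial (Fin n) k) {j : Fin n} (hj : j ∉ S) :
    twist S Ξ (X j) = X j := by
  rw [twist, aeval_X, if_neg hj]

/-- `twist_Ξ (C a) = C a` (the translation is `k`-linear).
[cite: CossartJannsenSaito2020, Def. 8.13 (pp. 120–121)] -/
@[simp] theorem twist_C (Ξ : Fin n → MvPolynomial (Fin n) k) (a : k) :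
    twist S Ξ (C a) = C a :=
  algHom_C _ _

/-- Twists fix `k[U]`. [folklore] -/
private theorem twist_eq_self_of_mem_supported (Ξ : Fin n → MvPolynomial (Fin n) k)
    {P : MvPolynomial (Fin n) k} (hP : P ∈ supported k {j : Fin n | j ∉ S}) : twist S Ξ P = P := by
  have hle : supported k {j : Fin n | j ∉ S} ≤ AlgHom.equalizer (twist S Ξ) (AlgHom.id k _) := by
    rw [supported_eq_adjoin_X]
    refine Algebra.adjoin_le ?_
    rintro _ ⟨j, hj, rfl⟩
    rw [SetLike.mem_coe, AlgHom.mem_equalizer, AlgHom.id_apply]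
    exact twist_X_of_not_mem Ξ hj
  exact (AlgHom.mem_equalizer _ _ _).mp (hle hP)

/-- Twists fix the polynomials all of whose monomials have `y`-degree `0`.
[cite: CossartJannsenSaito2020, Def. 8.13 (pp. 120–121)] -/
theorem twist_eq_self_of_forall_blockDeg_eq_zero (Ξ : Fin n → MvPolynomial (Fin n) k)
    {P : MvPolynomial (Fin n) k} (hP : ∀ d ∈ P.support, blockDeg S d = 0) : twist S Ξ P = P :=
  twist_eq_self_of_mem_supported Ξ (mem_supported_of_blockDeg S hP)

/-- **Group law**: for `Ξ' ∈ k[U]^S`, `twist_Ξ ∘ twist_{Ξ'} = twist_{Ξ + Ξ'}`. [folklore] -/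
private theorem twist_comp_twist (Ξ Ξ' : Fin n → MvPolynomial (Fin n) k)
    (hΞ' : ∀ i ∈ S, Ξ' i ∈ supported k {j : Fin n | j ∉ S}) :
    (twist S Ξ).comp (twist S Ξ') = twist S (Ξ + Ξ') := by
  refine MvPolynomial.algHom_ext fun i => ?_
  by_cases hi : i ∈ S
  · rw [AlgHom.comp_apply, twist_X_of_mem Ξ' hi, map_add, twist_X_of_mem Ξ hi,
      twist_eq_self_of_mem_supported Ξ (hΞ' i hi), twist_X_of_mem _ hi, Pi.add_apply, add_assoc]
  · rw [AlgHom.comp_apply, twist_X_of_not_mem Ξ' hi, twist_X_of_not_mem Ξ hi, twist_X_of_not_mem _ hi]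

/-- The twist extended to `k[X, T]` (`some i = X_i`, `none = T`; the ring of `translate`): `T ↦ T`,
`X_i ↦ X_i + Ξ_i (i ∈ S)`, `X_j ↦ X_j (j ∉ S)`.
[cite: CossartJannsenSaito2020, Def. 8.13 (pp. 120–121); CossartPiltant2008, proof of Prop. 4.2] -/
def twistT (S : Finset (Fin n)) (Ξ : Fin n → MvPolynomial (Fin n) k) :
    MvPolynomial (Option (Fin n)) k →ₐ[k] MvPolynomial (Option (Fin n)) k :=
  aeval fun o : Option (Fin n) => o.elim (X none) fun i =>
    if i ∈ S then X (some i) + rename some (Ξ i) else X (some i)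

/-- `twistT (T) = T`: the `y`-translation extended to `k[Y, T]` fixes the translation variable `T`.
[cite: CossartJannsenSaito2020, Def. 8.13 (pp. 120–121); CossartPiltant2008, proof of Prop. 4.2] -/
@[simp] theorem twistT_X_none (Ξ : Fin n → MvPolynomial (Fin n) k) :
    twistT S Ξ (X none) = X none := by
  simp [twistT]

/-- `twistT (X_i) = X_i + Ξ_i` for `i ∈ S`.
[cite: CossartJannsenSaito2020, Def. 8.13 (pp. 120–121); CossartPiltant2008, proof of Prop. 4.2] -/
@[simp] theorem twistT_X_some_of_mem (Ξ : Fin n → MvPolynomial (Fin n) k) {i : Fin n} (hi : i ∈ S) :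
    twistT S Ξ (X (some i)) = X (some i) + rename some (Ξ i) := by
  simp [twistT, hi]

/-- `twistT (X_j) = X_j` for `j ∉ S`.
[cite: CossartJannsenSaito2020, Def. 8.13 (pp. 120–121); CossartPiltant2008, proof of Prop. 4.2] -/
@[simp] theorem twistT_X_some_of_not_mem (Ξ : Fin n → MvPolynomial (Fin n) k) {j : Fin n}
    (hj : j ∉ S) : twistT S Ξ (X (some j)) = X (some j) := by
  simp [twistT, hj]

/-- `twistT (C a) = C a`.
[cite: CossartJannsenSaito2020, Def. 8.13 (pp. 120–121); CossartPiltant2008, proof of Prop. 4.2] -/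
@[simp] theorem twistT_C (Ξ : Fin n → MvPolynomial (Fin n) k) (a : k) :
    twistT S Ξ (C a) = C a :=
  algHom_C _ _

/-- `twistT` extends `twist`: `twistT ∘ ι = ι ∘ twist` for `ι : k[X] → k[X, T]` (`ι = rename some`, the
inclusion used by `translate` / `invarianceSpace`).
[cite: CossartJannsenSaito2020, Def. 8.13 (pp. 120–121); CossartPiltant2008, proof of Prop. 4.2] -/
theorem twistT_comp_rename (Ξ : Fin n → MvPolynomial (Fin n) k) :
    (twistT S Ξ).comp (rename some) = (rename some).comp (twist S Ξ) := by
  refine MvPolynomial.algHom_ext fun i => ?_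
  by_cases hi : i ∈ S
  · rw [AlgHom.comp_apply, AlgHom.comp_apply, rename_X, twistT_X_some_of_mem Ξ hi,
      twist_X_of_mem Ξ hi, map_add, rename_X]
  · rw [AlgHom.comp_apply, AlgHom.comp_apply, rename_X, twistT_X_some_of_not_mem Ξ hi,
      twist_X_of_not_mem Ξ hi, rename_X]

/-- Pointwise form of `twistT_comp_rename`: `twistT (ι H) = ι (twist H)`.
[cite: CossartJannsenSaito2020, Def. 8.13 (pp. 120–121); CossartPiltant2008, proof of Prop. 4.2] -/
theorem twistT_rename (Ξ : Fin n → MvPolynomial (Fin n) k) (H : MvPolynomial (Fin n) k) :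
    twistT S Ξ (rename some H) = rename some (twist S Ξ H) := by
  have := AlgHom.congr_fun (twistT_comp_rename (S := S) Ξ) H
  simpa only [AlgHom.comp_apply] using this

/-- `twistT_{−Ξ}` is a left inverse of `twistT_Ξ` for `Ξ ∈ k[U]^S`. [folklore] -/
private theorem twistT_neg_comp_twistT (Ξ : Fin n → MvPolynomial (Fin n) k)
    (hΞ : ∀ i ∈ S, Ξ i ∈ supported k {j : Fin n | j ∉ S}) :
    (twistT S (-Ξ)).comp (twistT S Ξ) = AlgHom.id k _ := by
  refine MvPolynomial.algHom_ext fun o => ?_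
  cases o with
  | none => simp
  | some i =>
    by_cases hi : i ∈ S
    · rw [AlgHom.comp_apply, twistT_X_some_of_mem Ξ hi, map_add, twistT_X_some_of_mem _ hi,
        twistT_rename, twist_eq_self_of_mem_supported _ (hΞ i hi), AlgHom.id_apply, Pi.neg_apply,
        map_neg, neg_add_cancel_right]
    · rw [AlgHom.comp_apply, twistT_X_some_of_not_mem Ξ hi, twistT_X_some_of_not_mem _ hi,
        AlgHom.id_apply]

/-- **Twists by `c`-invariant `Ξ ∈ k[U]^S` commute with the translation by `c`** (`c_S = 0`).
[cite: CossartPiltant2008, proof of Prop. 4.2; CossartJannsenSaito2020, Def. 8.13 (pp. 120–121)] -/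
theorem translate_comp_twistT {c : Fin n → k} (hcS : ∀ i ∈ S, c i = 0)
    (Ξ : Fin n → MvPolynomial (Fin n) k) (hinv : ∀ i ∈ S, c ∈ invarianceSpace k {Ξ i}) :
    (translate k c).comp (twistT S Ξ) = (twistT S Ξ).comp (translate k c) := by
  have hinv' : ∀ i ∈ S, translate k c (rename some (Ξ i)) = rename some (Ξ i) := fun i hi =>
    (mem_invarianceSpace_iff k).mp (hinv i hi) (Ξ i) rfl
  refine MvPolynomial.algHom_ext fun o => ?_
  cases o with
  | none => simp
  | some i =>
    by_cases hi : i ∈ S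
    · rw [AlgHom.comp_apply, AlgHom.comp_apply, twistT_X_some_of_mem Ξ hi, map_add, hinv' i hi,
        translate_X_some, hcS i hi, C_0, zero_mul, add_zero, twistT_X_some_of_mem Ξ hi]
    · rw [AlgHom.comp_apply, AlgHom.comp_apply, twistT_X_some_of_not_mem Ξ hi, translate_X_some,
        map_add, map_mul, twistT_C, twistT_X_none, twistT_X_some_of_not_mem Ξ hi]

/-- Lemma F, basic form: for `c` with `c_S = 0` and a `c`-invariant `Ξ ∈ k[U]^S`,
`c ∈ 𝕎(twist_Ξ H) ↔ c ∈ 𝕎(H)`. [folklore] -/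
private theorem mem_invarianceSpace_twist_iff {c : Fin n → k} (hcS : ∀ i ∈ S, c i = 0)
    {Ξ : Fin n → MvPolynomial (Fin n) k} (hΞ : ∀ i ∈ S, Ξ i ∈ supported k {j : Fin n | j ∉ S})
    (hinv : ∀ i ∈ S, c ∈ invarianceSpace k {Ξ i}) (H : MvPolynomial (Fin n) k) :
    c ∈ invarianceSpace k {twist S Ξ H} ↔ c ∈ invarianceSpace k {H} := by
  have hcomm := AlgHom.congr_fun (translate_comp_twistT hcS Ξ hinv) (rename some H)
  simp only [AlgHom.comp_apply] at hcomm
  have hinj : Function.Injective (twistT S Ξ) := fun x y hxy => by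
    have := congrArg (twistT S (-Ξ)) hxy
    rwa [← AlgHom.comp_apply, ← AlgHom.comp_apply, twistT_neg_comp_twistT Ξ hΞ, AlgHom.id_apply,
      AlgHom.id_apply] at this
  rw [mem_invarianceSpace_iff, mem_invarianceSpace_iff]
  simp only [Set.mem_singleton_iff, forall_eq]
  rw [← twistT_rename, hcomm]
  exact hinj.eq_iff

/-- **Lemma F (the twist group is abelian and commutes with `c`-translations).** For `c` with
`c_S = 0` and twists `Ξ, Ξ' ∈ k[U]^S` such that every `Ξ_i − Ξ'_i` is invariant under the translation
by `c`: `c ∈ 𝕎(twist_Ξ H) ↔ c ∈ 𝕎(twist_{Ξ'} H)`. Hence in an exhaustion over twists only a system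
of representatives modulo `c`-invariant ones matters. (Ours, elementary.)
[cite: CossartPiltant2008, proof of Prop. 4.2; CossartJannsenSaito2020, Def. 8.13 (pp. 120–121), Thm. 8.22 (a) (p. 124)] -/
theorem mem_invarianceSpace_twist_iff_of_sub_mem {c : Fin n → k} (hcS : ∀ i ∈ S, c i = 0)
    {Ξ Ξ' : Fin n → MvPolynomial (Fin n) k} (hΞ : ∀ i ∈ S, ∀ d ∈ (Ξ i).support, blockDeg S d = 0)
    (hΞ' : ∀ i ∈ S, ∀ d ∈ (Ξ' i).support, blockDeg S d = 0)
    (hinv : ∀ i ∈ S, c ∈ invarianceSpace k {Ξ i - Ξ' i}) (H : MvPolynomial (Fin n) k) :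
    c ∈ invarianceSpace k {twist S Ξ H} ↔ c ∈ invarianceSpace k {twist S Ξ' H} := by
  have hΞs : ∀ i ∈ S, Ξ i ∈ supported k {j : Fin n | j ∉ S} := fun i hi =>
    mem_supported_of_blockDeg S (hΞ i hi)
  have hΞ's : ∀ i ∈ S, Ξ' i ∈ supported k {j : Fin n | j ∉ S} := fun i hi =>
    mem_supported_of_blockDeg S (hΞ' i hi)
  have hD : ∀ i ∈ S, (Ξ - Ξ') i ∈ supported k {j : Fin n | j ∉ S} := fun i hi =>
    Subalgebra.sub_mem _ (hΞs i hi) (hΞ's i hi)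
  have hgrp : twist S Ξ H = twist S (Ξ - Ξ') (twist S Ξ' H) := by
    rw [← AlgHom.comp_apply, twist_comp_twist _ _ hΞ's, sub_add_cancel]
  rw [hgrp]
  exact mem_invarianceSpace_twist_iff hcS hD (fun i hi => hinv i hi) _

end Twist

/-! ## §3 The solution attached to a centre and the count by exhaustion of twists -/

section Count

variable {f : MvPolynomial (Fin n) k} {ν : ℕ} {S : Finset (Fin n)}

/-- For `i ∈ S` the attached form is `X_i`; `X_i ∈ k[T(Ψ, γ)]`. [folklore] -/
private theorem X_mem_linearFormsSubalgebra_competitorSpan {δ : ℚ}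
    {Ψ : MvPolynomial (Fin n) k ≃ₐ[k] MvPolynomial (Fin n) k} {γ : Fin n → ℚ} {i : Fin n}
    (hi : i ∈ S) : (X i : MvPolynomial (Fin n) k) ∈ linearFormsSubalgebra k (competitorSpan S ν δ Ψ γ) := by
  have h1 : linearFormPoly k (competitorForm S Ψ i) = X i := by
    rw [competitorForm, if_pos hi, linearFormPoly_proj]
  rw [← h1]
  exact Algebra.subset_adjoin ⟨competitorForm S Ψ i,
    Submodule.subset_span ⟨⟨i, Finset.mem_union_left _ hi⟩, rfl⟩, rfl⟩

/-- `ℓ_j ∈ k[T(Ψ, γ)]` for `j ∉ S` with `γ_j = 1/(νδ)`. [folklore] -/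
private theorem uLinearForm_mem_linearFormsSubalgebra_competitorSpan {δ : ℚ}
    {Ψ : MvPolynomial (Fin n) k ≃ₐ[k] MvPolynomial (Fin n) k} {γ : Fin n → ℚ} {j : Fin n}
    (hj : j ∉ S) (hγj : γ j = ((ν : ℚ) * δ)⁻¹) :
    linearFormPoly k (uLinearForm S (Ψ (X j))) ∈ linearFormsSubalgebra k (competitorSpan S ν δ Ψ γ) := by
  have h1 : linearFormPoly k (competitorForm S Ψ j) = linearFormPoly k (uLinearForm S (Ψ (X j))) := by
    rw [competitorForm, if_neg hj]
  rw [← h1]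
  exact Algebra.subset_adjoin ⟨competitorForm S Ψ j, Submodule.subset_span
    ⟨⟨j, Finset.mem_union_right _ (Finset.mem_filter.mpr ⟨Finset.mem_univ _, hj, hγj⟩)⟩, rfl⟩, rfl⟩

/-- **The solution attached to a centre.** Let `(f; X_S; X_{Sᶜ})` be `δ`-prepared, `δ = δ(f;u;y)`,
and `(Ψ; γ)` a centre for `f` with `γ = 1/ν` on `S`, `γ ≤ 1/(νδ)` off `S`. Then there is a twist
`Ξ ∈ k[U]^S`, every `Ξ_i` homogeneous of degree `δ` (pure-`u`), with `twist_Ξ (in_δ f) ∈ k[T(Ψ, γ)]`,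
`T(Ψ, γ) = ⟨X_S, ℓ_j : γ_j = 1/(νδ)⟩` — namely `Ξ = −A⁻¹Φ`, `A` the (invertible) `y`-block of the
Jacobian of `Ψ` at `0`, `Φ_i` the pure-`u` degree-`δ` parts of the `y'`-coordinates. (Ours, in the
model; for `δ ∉ ℕ`, `Ξ = 0` and this is the parent's `deltaInitial_mem_linearFormsSubalgebra_of_isCentreFor`.)
[cite: CossartJannsenSaito2020, Def. 8.13 (pp. 120–121), Thm. 8.16 (p. 121), Thm. 8.22 (a) (p. 124), Def. 8.2 (4) (p. 118); AbramovichTemkinWlodarczyk2024, Thm. 5.3.1 and its proof (2)–(3) (p. 1578), Lemma 5.2.10 (p. 1577); AbramovichQuekSchober2025, Thm. 3.5] -/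
theorem exists_twist_deltaInitial_mem_linearFormsSubalgebra (hord : monomialOrd (fun _ => 1) f = ν)
    (hτ : S.card = hironakaTau k {homogeneousComponent ν f})
    (hFS : ∀ d ∈ (homogeneousComponent ν f).support, ∀ j ∉ S, d j = 0)
    (hprep : IsDeltaPrepared S ν f) {δ : ℚ} (hδ : hironakaDelta S ν f = δ)
    {Ψ : MvPolynomial (Fin n) k ≃ₐ[k] MvPolynomial (Fin n) k} {γ : Fin n → ℚ}
    (h : IsCentreFor f Ψ γ) (hγS : ∀ i ∈ S, γ i = (ν : ℚ)⁻¹)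
    (hγle : ∀ j ∉ S, γ j ≤ ((ν : ℚ) * δ)⁻¹) :
    ∃ Ξ : Fin n → MvPolynomial (Fin n) k,
      (∀ i ∈ S, ∀ d ∈ (Ξ i).support, blockDeg S d = 0 ∧ (d.degree : ℚ) = δ) ∧
      twist S Ξ (deltaInitial S ν δ f) ∈ linearFormsSubalgebra k (competitorSpan S ν δ Ψ γ) := by
  classical
  have hΨ := h.1
  have hδ1 : 1 < δ := one_lt_hironakaDelta hord hFS hδ
  have hδpos : 0 < δ := one_pos.trans hδ1
  obtain ⟨p, q, hqpos, hpq⟩ := exists_eq_mul_den hδpos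
  have hqq : (0 : ℚ) < q := by exact_mod_cast hqpos
  have hp : 0 < p := by
    have : (0 : ℚ) < p := by rw [hpq]; positivity
    exact_mod_cast this
  have hqp : q < p := by
    have : (q : ℚ) < p := by rw [hpq]; nlinarith
    exact_mod_cast this
  obtain ⟨h1, h2, -, hpure⟩ :=
    deltaInitial_eq_aeval_of_isCentreFor hord hτ hFS hprep hδ hqpos hpq h hγS hγle
  set w : Fin n → ℕ := fun i => if i ∈ S then p else q with hw
  have hwpos : ∀ i, 0 < w i := fun i => by
    by_cases hi : i ∈ S
    · simp only [hw, if_pos hi]; exact hp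
    · simp only [hw, if_neg hi]; exact hqpos
  -- domination of the integer weights (as in the parent file)
  have hdom : ∀ i, (w i : ℕ∞) ≤ monomialOrd w (Ψ (X i)) := by
    refine blockWeights_le_monomialOrd hqp.le hΨ fun i hi d hd hb => ?_
    have h1' : δ ≤ (d.degree : ℚ) := hpure i hi d hd hb
    have : (p : ℚ) ≤ q * d.degree := by
      rw [hpq, mul_comm]; exact mul_le_mul_of_nonneg_left h1' hqq.le
    exact_mod_cast this
  -- the `y`-blocks of the Jacobians of `Ψ` and `Ψ⁻¹` at `0`
  set A : Matrix S S k := fun i l => coeff (Finsupp.single (l : Fin n) 1) (Ψ (X (i : Fin n))) with hA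
  set B : Matrix S S k := fun i l => coeff (Finsupp.single (l : Fin n) 1) (Ψ.symm (X (i : Fin n)))
    with hB
  have hfilt : ∀ i ∈ S, Finset.univ.filter (fun x => w x = w i) = S := by
    intro i hi
    ext x
    simp only [Finset.mem_filter, Finset.mem_univ, true_and, hw, if_pos hi]
    constructor
    · intro hx
      by_contra hxS
      rw [if_neg hxS] at hx
      exact hqp.ne hx
    · intro hxS
      rw [if_pos hxS]
  have hBA : B * A = 1 := by
    ext i l
    have key := sum_jacobianBlock_symm_mul_jacobianBlock w hwpos Ψ hdom (i := (i : Fin n))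
      (l := (l : Fin n)) (by simp only [hw, if_pos i.2, if_pos l.2])
    rw [hfilt i i.2, ← Finset.sum_coe_sort S] at key
    rw [Matrix.mul_apply, Matrix.one_apply, key]
    simp only [Subtype.ext_iff]
  have hAB : A * B = 1 := mul_eq_one_comm.mp hBA
  have hABe : ∀ i m : S, ∑ l : S, A i l * B l m = if i = m then 1 else 0 := fun i m => by
    rw [← Matrix.mul_apply, hAB, Matrix.one_apply]
  -- the twists `Φ` and the solution `Ξ = −A⁻¹ Φ = −B Φ`
  set Φ : Fin n → MvPolynomial (Fin n) k := fun i => uHomogeneousPart S δ (Ψ (X i)) with hΦ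
  have hΦpure : ∀ i, ∀ d ∈ (Φ i).support, blockDeg S d = 0 := fun i d hd =>
    (mem_support_uHomogeneousPart S hd).1
  set Ξ : Fin n → MvPolynomial (Fin n) k := fun l =>
    if hl : l ∈ S then -∑ m : S, C (B ⟨l, hl⟩ m) * Φ m else 0 with hΞ
  have hΞS : ∀ l : S, Ξ l = -∑ m : S, C (B l m) * Φ m := fun l => by
    simp only [hΞ, dif_pos l.2]
  have hΞpure : ∀ l ∈ S, ∀ d ∈ (Ξ l).support, blockDeg S d = 0 ∧ (d.degree : ℚ) = δ := by
    intro l hl d hd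
    by_contra hnot
    refine (mem_support_iff.mp hd) ?_
    rw [hΞS ⟨l, hl⟩, coeff_neg, coeff_sum]
    rw [Finset.sum_eq_zero fun m _ => ?_, neg_zero]
    rw [coeff_C_mul, hΦ, coeff_uHomogeneousPart, if_neg hnot, mul_zero]
  -- the key cancellation `Σ_{l ∈ S} a_{il} Ξ_l = −Φ_i`
  have hkey : ∀ i : S, ∑ l ∈ S, C (coeff (Finsupp.single l 1) (Ψ (X (i : Fin n)))) * Ξ l = -Φ i := by
    intro i
    rw [← Finset.sum_coe_sort S]
    have step1 : ∀ l : S, C (coeff (Finsupp.single (l : Fin n) 1) (Ψ (X (i : Fin n)))) * Ξ l =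
        -∑ m : S, C (A i l * B l m) * Φ m := fun l => by
      rw [hΞS l, mul_neg, Finset.mul_sum]
      congr 1
      refine Finset.sum_congr rfl fun m _ => ?_
      rw [← mul_assoc, ← C_mul]
    rw [Finset.sum_congr rfl fun l _ => step1 l, Finset.sum_neg_distrib, Finset.sum_comm]
    congr 1
    have step2 : ∀ m : S, ∑ l : S, C (A i l * B l m) * Φ m = C (∑ l : S, A i l * B l m) * Φ m :=
      fun m => by rw [map_sum, Finset.sum_mul]
    rw [Finset.sum_congr rfl fun m _ => step2 m]
    simp_rw [hABe]
    rw [Finset.sum_eq_single_of_mem i (Finset.mem_univ _) fun m _ hmi => by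
      rw [if_neg (Ne.symm hmi), C_0, zero_mul]]
    rw [if_pos rfl, C_1, one_mul]
  -- the structure of `in_δ f` through the centre
  set M := Finset.univ.filter (fun j => j ∉ S ∧ γ j = ((ν : ℚ) * δ)⁻¹) with hM
  set θ : Fin n → MvPolynomial (Fin n) k := fun i => weightedHomogeneousComponent
    (fun j => if j ∈ S then p else q) (if i ∈ S then p else q) (Ψ (X i)) with hθ
  set Hc := weightedHomogeneousComponent (fun i => if i ∈ S then p else q) (ν * p) (Ψ.symm f)
    with hHc
  refine ⟨Ξ, hΞpure, ?_⟩
  rw [h1, ← AlgHom.comp_apply, comp_aeval]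
  have hvars : (↑Hc.vars : Set (Fin n)) ⊆ ↑(S ∪ M) := by
    intro j hj
    rw [Finset.mem_coe, mem_vars_iff_mem_support] at hj
    obtain ⟨d, hd, hjd⟩ := hj
    rw [Finset.mem_coe, Finset.mem_union]
    by_contra hjSM
    push Not at hjSM
    have hjS : j ∉ S := hjSM.1
    have hγj : γ j ≠ ((ν : ℚ) * δ)⁻¹ := fun hγ =>
      hjSM.2 (Finset.mem_filter.mpr ⟨Finset.mem_univ _, hjS, hγ⟩)
    exact (Finsupp.mem_support_iff.mp hjd) (h2 d hd j hjS hγj)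
  have hmem : Hc ∈ Algebra.adjoin k (X '' (↑(S ∪ M) : Set (Fin n))) := mem_supported.mpr hvars
  have hmap : aeval (fun i => twist S Ξ (θ i)) Hc ∈
      (Algebra.adjoin k (X '' (↑(S ∪ M) : Set (Fin n)))).map (aeval fun i => twist S Ξ (θ i)) :=
    Subalgebra.mem_map.mpr ⟨Hc, hmem, rfl⟩
  rw [AlgHom.map_adjoin] at hmap
  refine Algebra.adjoin_le ?_ hmap
  rintro _ ⟨_, ⟨i, hi, rfl⟩, rfl⟩
  rw [SetLike.mem_coe, aeval_X]
  rcases Finset.mem_union.mp (Finset.mem_coe.mp hi) with hiS | hiM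
  · have hθi : θ i = (∑ l ∈ S, C (coeff (Finsupp.single l 1) (Ψ (X i))) * X l) + Φ i := by
      simp only [hθ, if_pos hiS]
      exact weightedHomogeneousComponent_high_eq hqp hqpos hpq _
    have htw : twist S Ξ (θ i) = ∑ l ∈ S, C (coeff (Finsupp.single l 1) (Ψ (X i))) * X l := by
      rw [hθi, map_add, map_sum, twist_eq_self_of_forall_blockDeg_eq_zero Ξ (hΦpure i)]
      have : ∀ l ∈ S, twist S Ξ (C (coeff (Finsupp.single l 1) (Ψ (X i))) * X l) =
          C (coeff (Finsupp.single l 1) (Ψ (X i))) * X l +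
            C (coeff (Finsupp.single l 1) (Ψ (X i))) * Ξ l := fun l hl => by
        rw [map_mul, twist_C, twist_X_of_mem Ξ hl, mul_add]
      rw [Finset.sum_congr rfl this, Finset.sum_add_distrib, hkey ⟨i, hiS⟩, add_assoc,
        neg_add_cancel, add_zero]
    rw [htw]
    refine sum_mem fun l hl => ?_
    rw [← smul_eq_C_mul]
    exact Subalgebra.smul_mem _ (X_mem_linearFormsSubalgebra_competitorSpan hl) _
  · obtain ⟨-, hiS, hγi⟩ := Finset.mem_filter.mp hiM
    have hθi : θ i = linearFormPoly k (uLinearForm S (Ψ (X i))) := by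
      simp only [hθ, if_neg hiS]
      exact weightedHomogeneousComponent_low_eq hqp hqpos _
    have htw : twist S Ξ (θ i) = θ i := by
      rw [hθi, linearFormPoly_uLinearForm, map_sum]
      exact Finset.sum_congr rfl fun l hl => by
        rw [map_mul, twist_C, twist_X_of_not_mem Ξ (Finset.mem_filter.mp hl).2]
    rw [htw, hθi]
    exact uLinearForm_mem_linearFormsSubalgebra_competitorSpan hiS hγi

/-- **The twisted count, unconditional in the competitor.** Under the hypotheses of
`exists_twist_deltaInitial_mem_linearFormsSubalgebra`: some twist `Ξ ∈ k[U]_δ^S` has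
`τ(twist_Ξ in_δ f) ≤ |S| + #{j ∉ S : γ_j = 1/(νδ)}` — i.e. `min_Ξ τ(twist_Ξ in_δ f) − |S|` is a lower
bound for the number of further weights EQUAL to `1/(νδ)` of every centre of the prefix class
`(1/ν)^{|S|}`. (Ours, in the model.)
[cite: CossartJannsenSaito2020, Thm. 8.16 (p. 121), Thm. 8.22 (a) (p. 124), Def. 8.2 (4) (p. 118); CossartPiltant2008, proof of Prop. 4.2; AbramovichTemkinWlodarczyk2024, Thm. 5.3.1 (p. 1578); AbramovichQuekSchober2025, Thm. 3.5] -/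
theorem exists_twist_hironakaTau_le_of_isCentreFor (hord : monomialOrd (fun _ => 1) f = ν)
    (hτ : S.card = hironakaTau k {homogeneousComponent ν f})
    (hFS : ∀ d ∈ (homogeneousComponent ν f).support, ∀ j ∉ S, d j = 0)
    (hprep : IsDeltaPrepared S ν f) {δ : ℚ} (hδ : hironakaDelta S ν f = δ)
    {Ψ : MvPolynomial (Fin n) k ≃ₐ[k] MvPolynomial (Fin n) k} {γ : Fin n → ℚ}
    (h : IsCentreFor f Ψ γ) (hγS : ∀ i ∈ S, γ i = (ν : ℚ)⁻¹)
    (hγle : ∀ j ∉ S, γ j ≤ ((ν : ℚ) * δ)⁻¹) :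
    ∃ Ξ : Fin n → MvPolynomial (Fin n) k,
      (∀ i ∈ S, ∀ d ∈ (Ξ i).support, blockDeg S d = 0 ∧ (d.degree : ℚ) = δ) ∧
      hironakaTau k {twist S Ξ (deltaInitial S ν δ f)} ≤
        S.card + (Finset.univ.filter (fun j => j ∉ S ∧ γ j = ((ν : ℚ) * δ)⁻¹)).card := by
  obtain ⟨Ξ, hΞ, hmem⟩ :=
    exists_twist_deltaInitial_mem_linearFormsSubalgebra hord hτ hFS hprep hδ h hγS hγle
  refine ⟨Ξ, hΞ, (hironakaTau_le_finrank_of_subset k ?_).trans (finrank_competitorSpan_le S ν δ Ψ γ)⟩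
  rintro _ rfl
  exact hmem

/-- `τ(S') ≤ dim T'` as soon as the translations along `T'^⊥` leave `S'` invariant. [cite: CossartPiltant2008, proof of Prop. 4.2] -/
theorem hironakaTau_le_finrank_of_dualCoannihilator_le {S' : Set (MvPolynomial (Fin n) k)}
    {T' : Submodule k (Module.Dual k (Fin n → k))}
    (hT : T'.dualCoannihilator ≤ invarianceSpace k S') : hironakaTau k S' ≤ Module.finrank k T' := by
  have h := Submodule.dualAnnihilator_anti hT
  rw [Subspace.dualCoannihilator_dualAnnihilator_eq] at h
  exact Submodule.finrank_mono h

/-- **The exhaustion of twists puts `T(Ψ, γ)^⊥` inside `𝕎(in_δ f)`.** Let `(f; X_S; X_{Sᶜ})` be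
`δ`-prepared, `δ = δ(f;u;y)`, and suppose that NO DEGREE-`δ` TWIST HIDES A `u`-DIRECTION USED BY THE
`δ`-FACE: for every `c ∈ kⁿ` with `c_S = 0` and `c ∉ 𝕎(in_δ f)` and every `Ξ ∈ k[U]^S` with all `Ξ_i`
homogeneous of degree `δ`, `c ∉ 𝕎(twist_Ξ in_δ f)`. Then for every centre `(Ψ; γ)` for `f` with
`γ = 1/ν` on `S` and `γ ≤ 1/(νδ)` off `S`, the translations along `T(Ψ, γ)^⊥` leave `in_δ f` invariant.
(Ours, in the model: the solution `Ξ(Ψ)` of `exists_twist_deltaInitial_mem_linearFormsSubalgebra`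
puts `T(Ψ, γ)^⊥ ⊆ 𝕎(twist_Ξ in_δ f)`, its vectors have `c_S = 0`, and the hypothesis moves them into
`𝕎(in_δ f)`.)
[cite: CossartJannsenSaito2020, Thm. 8.16 (p. 121), Thm. 8.22 (a) (p. 124), Def. 8.13 (pp. 120–121), Def. 8.2 (4) (p. 118); CossartPiltant2008, proof of Prop. 4.2; AbramovichTemkinWlodarczyk2024, Thm. 5.3.1 (p. 1578); AbramovichQuekSchober2025, Thm. 3.5] -/
theorem dualCoannihilator_competitorSpan_le_invarianceSpace_of_forall_twist
    (hord : monomialOrd (fun _ => 1) f = ν)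
    (hτ : S.card = hironakaTau k {homogeneousComponent ν f})
    (hFS : ∀ d ∈ (homogeneousComponent ν f).support, ∀ j ∉ S, d j = 0)
    (hprep : IsDeltaPrepared S ν f) {δ : ℚ} (hδ : hironakaDelta S ν f = δ)
    (hcount : ∀ c : Fin n → k, (∀ i ∈ S, c i = 0) → c ∉ invarianceSpace k {deltaInitial S ν δ f} →
      ∀ Ξ : Fin n → MvPolynomial (Fin n) k,
        (∀ i ∈ S, ∀ d ∈ (Ξ i).support, blockDeg S d = 0 ∧ (d.degree : ℚ) = δ) →
        c ∉ invarianceSpace k {twist S Ξ (deltaInitial S ν δ f)})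
    {Ψ : MvPolynomial (Fin n) k ≃ₐ[k] MvPolynomial (Fin n) k} {γ : Fin n → ℚ}
    (h : IsCentreFor f Ψ γ) (hγS : ∀ i ∈ S, γ i = (ν : ℚ)⁻¹)
    (hγle : ∀ j ∉ S, γ j ≤ ((ν : ℚ) * δ)⁻¹) :
    (competitorSpan S ν δ Ψ γ).dualCoannihilator ≤ invarianceSpace k {deltaInitial S ν δ f} := by
  obtain ⟨Ξ, hΞ, hmem⟩ :=
    exists_twist_deltaInitial_mem_linearFormsSubalgebra hord hτ hFS hprep hδ h hγS hγle
  intro c hc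
  have hcW : c ∈ invarianceSpace k {twist S Ξ (deltaInitial S ν δ f)} :=
    dualCoannihilator_le_invarianceSpace k (by rintro _ rfl; exact hmem) hc
  have hcS : ∀ i ∈ S, c i = 0 := fun i hi => by
    have := (Submodule.mem_dualCoannihilator c).mp hc (competitorForm S Ψ i)
      (Submodule.subset_span ⟨⟨i, Finset.mem_union_left _ hi⟩, rfl⟩)
    rwa [competitorForm, if_pos hi, LinearMap.proj_apply] at this
  by_contra hcW0
  exact hcount c hcS hcW0 Ξ hΞ hcW

/-- **The count by exhaustion of twists.** Let `(f; X_S; X_{Sᶜ})` be `δ`-prepared, `δ = δ(f;u;y)`.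
Suppose that NO DEGREE-`δ` TWIST HIDES A `u`-DIRECTION USED BY THE `δ`-FACE: for every `c ∈ kⁿ` with
`c_S = 0` and `c ∉ 𝕎(in_δ f)` and every `Ξ ∈ k[U]^S` with all `Ξ_i` homogeneous of degree `δ`,
`c ∉ 𝕎(twist_Ξ in_δ f)`. Then every centre `(Ψ; γ)` for `f` with `γ = 1/ν` on `S` and `γ ≤ 1/(νδ)`
off `S` has at least `τ(in_δ f) − |S|` weights EQUAL to `1/(νδ)` off `S`:
`τ(in_δ f) ≤ |S| + #{j ∉ S : γ_j = 1/(νδ)}`. (Ours, in the model; from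
`dualCoannihilator_competitorSpan_le_invarianceSpace_of_forall_twist` and `dim T(Ψ, γ) ≤ |S| + #M(γ)`.)
[cite: CossartJannsenSaito2020, Thm. 8.16 (p. 121), Thm. 8.22 (a) (p. 124), Def. 8.13 (pp. 120–121), Def. 8.2 (4) (p. 118); CossartPiltant2008, proof of Prop. 4.2; AbramovichTemkinWlodarczyk2024, Thm. 5.3.1 (p. 1578); AbramovichQuekSchober2025, Thm. 3.5] -/
theorem hironakaTau_deltaInitial_le_of_forall_twist (hord : monomialOrd (fun _ => 1) f = ν)
    (hτ : S.card = hironakaTau k {homogeneousComponent ν f})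
    (hFS : ∀ d ∈ (homogeneousComponent ν f).support, ∀ j ∉ S, d j = 0)
    (hprep : IsDeltaPrepared S ν f) {δ : ℚ} (hδ : hironakaDelta S ν f = δ)
    (hcount : ∀ c : Fin n → k, (∀ i ∈ S, c i = 0) → c ∉ invarianceSpace k {deltaInitial S ν δ f} →
      ∀ Ξ : Fin n → MvPolynomial (Fin n) k,
        (∀ i ∈ S, ∀ d ∈ (Ξ i).support, blockDeg S d = 0 ∧ (d.degree : ℚ) = δ) →
        c ∉ invarianceSpace k {twist S Ξ (deltaInitial S ν δ f)})
    {Ψ : MvPolynomial (Fin n) k ≃ₐ[k] MvPolynomial (Fin n) k} {γ : Fin n → ℚ}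
    (h : IsCentreFor f Ψ γ) (hγS : ∀ i ∈ S, γ i = (ν : ℚ)⁻¹)
    (hγle : ∀ j ∉ S, γ j ≤ ((ν : ℚ) * δ)⁻¹) :
    hironakaTau k {deltaInitial S ν δ f} ≤
      S.card + (Finset.univ.filter (fun j => j ∉ S ∧ γ j = ((ν : ℚ) * δ)⁻¹)).card :=
  (hironakaTau_le_finrank_of_dualCoannihilator_le
    (dualCoannihilator_competitorSpan_le_invarianceSpace_of_forall_twist hord hτ hFS hprep hδ hcount
      h hγS hγle)).trans (finrank_competitorSpan_le S ν δ Ψ γ)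

/-- **The hand-over.** Under the same exhaustion hypothesis, a centre of the prefix class that ATTAINS
the count — at most (hence exactly) `τ(in_δ f) − |S|` weights equal to `1/(νδ)` off `S` — has its
competitor forms spanning PRECISELY the directrix of the `δ`-face: `T(in_δ f) = T(Ψ, γ) =
⟨X_i (i ∈ S), ℓ_j (j ∈ M(γ))⟩`, i.e. the `u`-linear parts `ℓ_j` of its weight-`1/(νδ)` coordinates
together with `X_S` cut out exactly `𝕎(in_δ f)` (the input the next stage starts from). (Ours, in the
model: `T(in_δ f) = 𝕎(in_δ f)^⊥ ≤ T(Ψ, γ)^⊥⊥ = T(Ψ, γ)` and `dim T(Ψ, γ) ≤ |S| + #M(γ) ≤ τ(in_δ f)`.)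
[cite: CossartJannsenSaito2020, Thm. 8.16 (p. 121), Thm. 8.22 (a) (p. 124), Def. 8.13 (pp. 120–121), Def. 8.2 (4) (p. 118); CossartPiltant2008, proof of Prop. 4.2; AbramovichTemkinWlodarczyk2024, Thm. 5.3.1 (p. 1578); AbramovichQuekSchober2025, Thm. 3.5] -/
theorem directrix_deltaInitial_eq_competitorSpan_of_forall_twist
    (hord : monomialOrd (fun _ => 1) f = ν)
    (hτ : S.card = hironakaTau k {homogeneousComponent ν f})
    (hFS : ∀ d ∈ (homogeneousComponent ν f).support, ∀ j ∉ S, d j = 0)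
    (hprep : IsDeltaPrepared S ν f) {δ : ℚ} (hδ : hironakaDelta S ν f = δ)
    (hcount : ∀ c : Fin n → k, (∀ i ∈ S, c i = 0) → c ∉ invarianceSpace k {deltaInitial S ν δ f} →
      ∀ Ξ : Fin n → MvPolynomial (Fin n) k,
        (∀ i ∈ S, ∀ d ∈ (Ξ i).support, blockDeg S d = 0 ∧ (d.degree : ℚ) = δ) →
        c ∉ invarianceSpace k {twist S Ξ (deltaInitial S ν δ f)})
    {Ψ : MvPolynomial (Fin n) k ≃ₐ[k] MvPolynomial (Fin n) k} {γ : Fin n → ℚ}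
    (h : IsCentreFor f Ψ γ) (hγS : ∀ i ∈ S, γ i = (ν : ℚ)⁻¹)
    (hγle : ∀ j ∉ S, γ j ≤ ((ν : ℚ) * δ)⁻¹)
    (hattain : S.card + (Finset.univ.filter (fun j => j ∉ S ∧ γ j = ((ν : ℚ) * δ)⁻¹)).card ≤
      hironakaTau k {deltaInitial S ν δ f}) :
    directrix k {deltaInitial S ν δ f} = competitorSpan S ν δ Ψ γ := by
  have hle : directrix k {deltaInitial S ν δ f} ≤ competitorSpan S ν δ Ψ γ := by
    have h' := Submodule.dualAnnihilator_anti
      (dualCoannihilator_competitorSpan_le_invarianceSpace_of_forall_twist hord hτ hFS hprep hδ hcount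
        h hγS hγle)
    rwa [Subspace.dualCoannihilator_dualAnnihilator_eq] at h'
  exact Submodule.eq_of_le_of_finrank_le hle ((finrank_competitorSpan_le S ν δ Ψ γ).trans hattain)

/-- For `δ ∉ ℕ` the only degree-`δ` twist is `Ξ = 0` (Thm. 8.22 (a): solutions are `c_i U^v`,
`v ∈ ℕ^e`), so the exhaustion hypothesis of `hironakaTau_deltaInitial_le_of_forall_twist` holds for
trivial reasons and that theorem specialises to the parent's
`hironakaTau_deltaInitial_le_of_forall_natCast_ne`. (Ours, elementary.)
[cite: CossartJannsenSaito2020, Thm. 8.22 (a) (p. 124), Def. 8.13 (pp. 120–121)] -/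
theorem not_mem_invarianceSpace_twist_of_forall_natCast_ne {δ : ℚ} (hδint : ∀ m : ℕ, (m : ℚ) ≠ δ)
    {c : Fin n → k} {H : MvPolynomial (Fin n) k} (hc : c ∉ invarianceSpace k {H})
    {Ξ : Fin n → MvPolynomial (Fin n) k}
    (hΞ : ∀ i ∈ S, ∀ d ∈ (Ξ i).support, blockDeg S d = 0 ∧ (d.degree : ℚ) = δ) :
    c ∉ invarianceSpace k {twist S Ξ H} := by
  have hΞ0 : ∀ i ∈ S, Ξ i = 0 := fun i hi => by
    by_contra hne
    obtain ⟨d, hd⟩ := ne_zero_iff.mp hne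
    exact hδint d.degree (hΞ i hi d (mem_support_iff.mpr hd)).2
  have hid : twist S Ξ = AlgHom.id k _ := MvPolynomial.algHom_ext fun i => by
    by_cases hi : i ∈ S
    · rw [twist_X_of_mem Ξ hi, hΞ0 i hi, add_zero, AlgHom.id_apply]
    · rw [twist_X_of_not_mem Ξ hi, AlgHom.id_apply]
  rwa [hid, AlgHom.id_apply]

/-- **Representatives suffice (Lemma F applied).** If for each direction `c` (`c_S = 0`,
`c ∉ 𝕎(in_δ f)`) and each degree-`δ` twist `Ξ` SOME twist `Ξ' ∈ k[U]^S` congruent to `Ξ` modulo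
`c`-translation-invariant polynomials has `c ∉ 𝕎(twist_{Ξ'} in_δ f)`, then the full exhaustion
hypothesis holds. (Ours, in the model; e.g. in `u`-coordinates adapted to `c` the `c`-pure parts `Ξ'`
represent, their complements lying in `k[R']` and being `c`-invariant by
`dualCoannihilator_le_invarianceSpace`.)
[cite: CossartJannsenSaito2020, Def. 8.13 (pp. 120–121), Thm. 8.22 (a) (p. 124); CossartPiltant2008, proof of Prop. 4.2] -/
theorem forall_twist_of_forall_twist_repr {δ : ℚ}
    (hrepr : ∀ c : Fin n → k, (∀ i ∈ S, c i = 0) → c ∉ invarianceSpace k {deltaInitial S ν δ f} →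
      ∀ Ξ : Fin n → MvPolynomial (Fin n) k,
        (∀ i ∈ S, ∀ d ∈ (Ξ i).support, blockDeg S d = 0 ∧ (d.degree : ℚ) = δ) →
        ∃ Ξ' : Fin n → MvPolynomial (Fin n) k, (∀ i ∈ S, ∀ d ∈ (Ξ' i).support, blockDeg S d = 0) ∧
          (∀ i ∈ S, c ∈ invarianceSpace k {Ξ i - Ξ' i}) ∧
          c ∉ invarianceSpace k {twist S Ξ' (deltaInitial S ν δ f)}) :
    ∀ c : Fin n → k, (∀ i ∈ S, c i = 0) → c ∉ invarianceSpace k {deltaInitial S ν δ f} →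
      ∀ Ξ : Fin n → MvPolynomial (Fin n) k,
        (∀ i ∈ S, ∀ d ∈ (Ξ i).support, blockDeg S d = 0 ∧ (d.degree : ℚ) = δ) →
        c ∉ invarianceSpace k {twist S Ξ (deltaInitial S ν δ f)} := by
  intro c hcS hcW Ξ hΞ hmem
  obtain ⟨Ξ', hΞ', hinv, hnot⟩ := hrepr c hcS hcW Ξ hΞ
  exact hnot ((mem_invarianceSpace_twist_iff_of_sub_mem hcS (fun i hi d hd => (hΞ i hi d hd).1)
    hΞ' hinv _).mp hmem)

/-- **The count by exhaustion of twist REPRESENTATIVES.** As `hironakaTau_deltaInitial_le_of_forall_twist`,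
but for each direction `c` it suffices to test, for every degree-`δ` twist `Ξ`, SOME twist `Ξ' ∈ k[U]^S`
congruent to it modulo `c`-translation-invariant polynomials (Lemma F); e.g. for `c = e_j` the
`X_j`-divisible parts. (Ours, in the model.)
[cite: CossartJannsenSaito2020, Thm. 8.16 (p. 121), Thm. 8.22 (a) (p. 124), Def. 8.13 (pp. 120–121); CossartPiltant2008, proof of Prop. 4.2; AbramovichTemkinWlodarczyk2024, Thm. 5.3.1 (p. 1578); AbramovichQuekSchober2025, Thm. 3.5] -/
theorem hironakaTau_deltaInitial_le_of_forall_twist_repr (hord : monomialOrd (fun _ => 1) f = ν)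
    (hτ : S.card = hironakaTau k {homogeneousComponent ν f})
    (hFS : ∀ d ∈ (homogeneousComponent ν f).support, ∀ j ∉ S, d j = 0)
    (hprep : IsDeltaPrepared S ν f) {δ : ℚ} (hδ : hironakaDelta S ν f = δ)
    (hrepr : ∀ c : Fin n → k, (∀ i ∈ S, c i = 0) → c ∉ invarianceSpace k {deltaInitial S ν δ f} →
      ∀ Ξ : Fin n → MvPolynomial (Fin n) k,
        (∀ i ∈ S, ∀ d ∈ (Ξ i).support, blockDeg S d = 0 ∧ (d.degree : ℚ) = δ) →
        ∃ Ξ' : Fin n → MvPolynomial (Fin n) k, (∀ i ∈ S, ∀ d ∈ (Ξ' i).support, blockDeg S d = 0) ∧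
          (∀ i ∈ S, c ∈ invarianceSpace k {Ξ i - Ξ' i}) ∧
          c ∉ invarianceSpace k {twist S Ξ' (deltaInitial S ν δ f)})
    {Ψ : MvPolynomial (Fin n) k ≃ₐ[k] MvPolynomial (Fin n) k} {γ : Fin n → ℚ}
    (h : IsCentreFor f Ψ γ) (hγS : ∀ i ∈ S, γ i = (ν : ℚ)⁻¹)
    (hγle : ∀ j ∉ S, γ j ≤ ((ν : ℚ) * δ)⁻¹) :
    hironakaTau k {deltaInitial S ν δ f} ≤
      S.card + (Finset.univ.filter (fun j => j ∉ S ∧ γ j = ((ν : ℚ) * δ)⁻¹)).card :=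
  hironakaTau_deltaInitial_le_of_forall_twist hord hτ hFS hprep hδ
    (forall_twist_of_forall_twist_repr hrepr) h hγS hγle

/-- The hand-over from representatives (`directrix_deltaInitial_eq_competitorSpan_of_forall_twist` with
the hypothesis of `hironakaTau_deltaInitial_le_of_forall_twist_repr`). (Ours, in the model.)
[cite: CossartJannsenSaito2020, Thm. 8.16 (p. 121), Thm. 8.22 (a) (p. 124), Def. 8.13 (pp. 120–121); CossartPiltant2008, proof of Prop. 4.2; AbramovichTemkinWlodarczyk2024, Thm. 5.3.1 (p. 1578); AbramovichQuekSchober2025, Thm. 3.5] -/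
theorem directrix_deltaInitial_eq_competitorSpan_of_forall_twist_repr
    (hord : monomialOrd (fun _ => 1) f = ν)
    (hτ : S.card = hironakaTau k {homogeneousComponent ν f})
    (hFS : ∀ d ∈ (homogeneousComponent ν f).support, ∀ j ∉ S, d j = 0)
    (hprep : IsDeltaPrepared S ν f) {δ : ℚ} (hδ : hironakaDelta S ν f = δ)
    (hrepr : ∀ c : Fin n → k, (∀ i ∈ S, c i = 0) → c ∉ invarianceSpace k {deltaInitial S ν δ f} →
      ∀ Ξ : Fin n → MvPolynomial (Fin n) k,
        (∀ i ∈ S, ∀ d ∈ (Ξ i).support, blockDeg S d = 0 ∧ (d.degree : ℚ) = δ) →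
        ∃ Ξ' : Fin n → MvPolynomial (Fin n) k, (∀ i ∈ S, ∀ d ∈ (Ξ' i).support, blockDeg S d = 0) ∧
          (∀ i ∈ S, c ∈ invarianceSpace k {Ξ i - Ξ' i}) ∧
          c ∉ invarianceSpace k {twist S Ξ' (deltaInitial S ν δ f)})
    {Ψ : MvPolynomial (Fin n) k ≃ₐ[k] MvPolynomial (Fin n) k} {γ : Fin n → ℚ}
    (h : IsCentreFor f Ψ γ) (hγS : ∀ i ∈ S, γ i = (ν : ℚ)⁻¹)
    (hγle : ∀ j ∉ S, γ j ≤ ((ν : ℚ) * δ)⁻¹)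
    (hattain : S.card + (Finset.univ.filter (fun j => j ∉ S ∧ γ j = ((ν : ℚ) * δ)⁻¹)).card ≤
      hironakaTau k {deltaInitial S ν δ f}) :
    directrix k {deltaInitial S ν δ f} = competitorSpan S ν δ Ψ γ :=
  directrix_deltaInitial_eq_competitorSpan_of_forall_twist hord hτ hFS hprep hδ
    (forall_twist_of_forall_twist_repr hrepr) h hγS hγle hattain

end Count

/-! ## §8 (rev. 2) `y`-slices of twists: the first-order Taylor formula -/

section Slices

variable {S : Finset (Fin n)}

/-- The indicator weight of `S` reads off the `y`-degree. [folklore] -/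
private theorem weight_indicator (d : Fin n →₀ ℕ) :
    weight (fun i => if i ∈ S then 1 else 0) d = blockDeg S d := by
  classical
  rw [Finsupp.weight_apply, Finsupp.sum_fintype _ _ (fun _ => by simp), blockDeg_eq_sum_univ]
  simp only [smul_eq_mul, mul_ite, mul_one, mul_zero]
  rw [← Finset.sum_filter]
  congr 1
  ext i; simp

/-- Coefficients of the `y`-degree-`m` slice. [folklore] -/
private theorem coeff_ySlice (m : ℕ) (H : MvPolynomial (Fin n) k) (d : Fin n →₀ ℕ) :
    coeff d (weightedHomogeneousComponent (fun i => if i ∈ S then 1 else 0) m H) =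
      if blockDeg S d = m then coeff d H else 0 := by
  rw [coeff_weightedHomogeneousComponent, weight_indicator]

/-- Removing one `y`-variable lowers the `y`-degree by one. [folklore] -/
private theorem blockDeg_tsub_single {d : Fin n →₀ ℕ} {i : Fin n} (hi : i ∈ S) (hd : i ∈ d.support) :
    blockDeg S (d - Finsupp.single i 1) + 1 = blockDeg S d := by
  classical
  rw [blockDeg_eq_sum_univ, blockDeg_eq_sum_univ, ← Finset.add_sum_erase S _ hi,
    ← Finset.add_sum_erase S _ hi]
  have h1 : ∑ x ∈ S.erase i, (d - Finsupp.single i 1 : Fin n →₀ ℕ) x = ∑ x ∈ S.erase i, d x :=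
    Finset.sum_congr rfl fun x hx => by
      rw [Finsupp.tsub_apply, Finsupp.single_apply, if_neg (Finset.ne_of_mem_erase hx).symm,
        Nat.sub_zero]
  rw [h1, Finsupp.tsub_apply, Finsupp.single_apply, if_pos rfl]
  have := Finsupp.mem_support_iff.mp hd
  omega

/-- Removing a `u`-variable keeps the `y`-degree. [folklore] -/
private theorem blockDeg_tsub_single_of_not_mem {d : Fin n →₀ ℕ} {j : Fin n} (hj : j ∉ S) :
    blockDeg S (d - Finsupp.single j 1) = blockDeg S d := by
  classical
  rw [blockDeg_eq_sum_univ, blockDeg_eq_sum_univ]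
  exact Finset.sum_congr rfl fun x hx => by
    have hne : j ≠ x := fun h => hj (h ▸ hx)
    rw [Finsupp.tsub_apply, Finsupp.single_apply, if_neg hne, Nat.sub_zero]

/-- Slices of `Q · X_i`, `i ∈ S`: the `y`-degree shifts by one. [folklore] -/
private theorem ySlice_succ_mul_X_of_mem {i : Fin n} (hi : i ∈ S) (m : ℕ) (Q : MvPolynomial (Fin n) k) :
    weightedHomogeneousComponent (fun i => if i ∈ S then 1 else 0) (m + 1) (Q * X i) =
      weightedHomogeneousComponent (fun i => if i ∈ S then 1 else 0) m Q * X i := by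
  classical
  ext d
  rw [coeff_ySlice, coeff_mul_X', coeff_mul_X', coeff_ySlice]
  by_cases hd : i ∈ d.support
  · rw [if_pos hd, if_pos hd, ← blockDeg_tsub_single hi hd]
    simp only [add_left_inj]
  · rw [if_neg hd, if_neg hd, ite_self]

/-- The `y`-degree-`0` slice of `Q · X_i`, `i ∈ S`, vanishes. [folklore] -/
private theorem ySlice_zero_mul_X_of_mem {i : Fin n} (hi : i ∈ S) (Q : MvPolynomial (Fin n) k) :
    weightedHomogeneousComponent (fun i => if i ∈ S then 1 else 0) 0 (Q * X i) = 0 := by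
  classical
  ext d
  rw [coeff_ySlice, coeff_mul_X', coeff_zero]
  by_cases hd : i ∈ d.support
  · rw [if_pos hd, ← blockDeg_tsub_single hi hd]
    simp
  · rw [if_neg hd, ite_self]

/-- Slices of `Q · X_j`, `j ∉ S`. [folklore] -/
private theorem ySlice_mul_X_of_not_mem {j : Fin n} (hj : j ∉ S) (m : ℕ) (Q : MvPolynomial (Fin n) k) :
    weightedHomogeneousComponent (fun i => if i ∈ S then 1 else 0) m (Q * X j) =
      weightedHomogeneousComponent (fun i => if i ∈ S then 1 else 0) m Q * X j := by
  classical
  ext d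
  rw [coeff_ySlice, coeff_mul_X', coeff_mul_X', coeff_ySlice]
  by_cases hd : j ∈ d.support
  · rw [if_pos hd, if_pos hd, blockDeg_tsub_single_of_not_mem hj]
  · rw [if_neg hd, if_neg hd, ite_self]

/-- Slices of `Q · B` for `B ∈ k[U]` (all monomials of `y`-degree `0`). [folklore] -/
private theorem ySlice_mul_of_blockDeg_eq_zero (m : ℕ) (Q : MvPolynomial (Fin n) k)
    {B : MvPolynomial (Fin n) k} (hB : ∀ e ∈ B.support, blockDeg S e = 0) :
    weightedHomogeneousComponent (fun i => if i ∈ S then 1 else 0) m (Q * B) =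
      weightedHomogeneousComponent (fun i => if i ∈ S then 1 else 0) m Q * B := by
  classical
  conv_lhs => rw [B.as_sum, Finset.mul_sum, map_sum]
  conv_rhs => rw [B.as_sum, Finset.mul_sum]
  refine Finset.sum_congr rfl fun e he => ?_
  ext d
  rw [coeff_ySlice, coeff_mul_monomial', coeff_mul_monomial', coeff_ySlice]
  by_cases hed : e ≤ d
  · have hbd : blockDeg S (d - e) = blockDeg S d := by
      rw [blockDeg_eq_sum_univ, blockDeg_eq_sum_univ]
      refine Finset.sum_congr rfl fun x hx => ?_
      rw [Finsupp.tsub_apply]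
      have : e x = 0 := by
        by_contra hne
        have hx' : x ∈ e.support := Finsupp.mem_support_iff.mpr hne
        have h0 := hB e he
        rw [blockDeg_eq_sum_univ] at h0
        exact hne (Finset.sum_eq_zero_iff.mp h0 x hx)
      rw [this, Nat.sub_zero]
    rw [if_pos hed, if_pos hed, hbd]
    split_ifs <;> simp
  · rw [if_neg hed, if_neg hed, ite_self]

/-- Slices of a monomial. [folklore] -/
private theorem ySlice_monomial (m : ℕ) (d : Fin n →₀ ℕ) (a : k) :
    weightedHomogeneousComponent (fun i => if i ∈ S then 1 else 0) m (monomial d a) =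
      if blockDeg S d = m then monomial d a else 0 := by
  classical
  ext e
  rw [coeff_ySlice, coeff_monomial]
  by_cases hde : d = e
  · subst hde
    by_cases hb : blockDeg S d = m
    · rw [if_pos hb, if_pos rfl, if_pos hb, coeff_monomial, if_pos rfl]
    · rw [if_neg hb, if_neg hb, coeff_zero]
  · rw [if_neg hde, ite_self]
    by_cases hb : blockDeg S d = m
    · rw [if_pos hb, coeff_monomial, if_neg hde]
    · rw [if_neg hb, coeff_zero]

/-- For `l ∈ S`, `∂_l` kills the `y`-degree-`0` slice. [folklore] -/
private theorem pderiv_ySlice_zero {l : Fin n} (hl : l ∈ S) (Q : MvPolynomial (Fin n) k) :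
    pderiv l (weightedHomogeneousComponent (fun i => if i ∈ S then 1 else 0) 0 Q) = 0 := by
  classical
  conv_lhs => rw [(weightedHomogeneousComponent (fun i => if i ∈ S then 1 else 0) 0 Q).as_sum, map_sum]
  refine Finset.sum_eq_zero fun e he => ?_
  rw [pderiv_monomial]
  have h0 : blockDeg S e = 0 := by
    have := mem_support_iff.mp he
    rw [coeff_ySlice] at this
    by_contra h; exact this (if_neg h)
  rw [(blockDeg_eq_zero_iff S e).mp h0 l hl, Nat.cast_zero, mul_zero, monomial_zero]

/-- The Leibniz rule for `Σ_{l ∈ S} Ξ_l ∂_l` against `X_i`, `i ∈ S`. [folklore] -/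
private theorem sum_mul_pderiv_mul_X_of_mem (Ξ : Fin n → MvPolynomial (Fin n) k) {i : Fin n}
    (hi : i ∈ S) (W : MvPolynomial (Fin n) k) :
    ∑ l ∈ S, Ξ l * pderiv l (W * X i) = (∑ l ∈ S, Ξ l * pderiv l W) * X i + W * Ξ i := by
  classical
  simp_rw [pderiv_mul, mul_add, Finset.sum_add_distrib, Finset.sum_mul, mul_assoc]
  congr 1
  rw [Finset.sum_eq_single_of_mem i hi fun l _ hne => by rw [pderiv_X_of_ne hne.symm, mul_zero, mul_zero],
    pderiv_X_self, mul_one, mul_comm]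

/-- The Leibniz rule for `Σ_{l ∈ S} Ξ_l ∂_l` against `X_j`, `j ∉ S`. [folklore] -/
private theorem sum_mul_pderiv_mul_X_of_not_mem (Ξ : Fin n → MvPolynomial (Fin n) k) {j : Fin n}
    (hj : j ∉ S) (W : MvPolynomial (Fin n) k) :
    ∑ l ∈ S, Ξ l * pderiv l (W * X j) = (∑ l ∈ S, Ξ l * pderiv l W) * X j := by
  simp_rw [pderiv_mul, mul_add, Finset.sum_add_distrib, Finset.sum_mul, mul_assoc]
  rw [add_eq_left]
  exact Finset.sum_eq_zero fun l hl => by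
    rw [pderiv_X_of_ne (ne_of_mem_of_not_mem hl hj).symm, mul_zero, mul_zero]

/-- **First-order Taylor formula for the slices of a twisted monomial** (induction on the degree).
[folklore] -/
private theorem ySlice_twist_monomial (Ξ : Fin n → MvPolynomial (Fin n) k)
    (hΞ : ∀ i ∈ S, ∀ e ∈ (Ξ i).support, blockDeg S e = 0) :
    ∀ (N : ℕ) (d : Fin n →₀ ℕ), d.degree = N → ∀ (a : k) (m : ℕ), blockDeg S d ≤ m + 1 →
      weightedHomogeneousComponent (fun i => if i ∈ S then 1 else 0) m (twist S Ξ (monomial d a)) =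
        weightedHomogeneousComponent (fun i => if i ∈ S then 1 else 0) m (monomial d a) +
          ∑ l ∈ S, Ξ l * pderiv l
            (weightedHomogeneousComponent (fun i => if i ∈ S then 1 else 0) (m + 1) (monomial d a)) := by
  classical
  intro N
  induction N with
  | zero =>
    intro d hd a m _
    obtain rfl : d = 0 := (Finsupp.degree_eq_zero_iff d).mp hd
    have hC : (monomial (0 : Fin n →₀ ℕ) a : MvPolynomial (Fin n) k) = C a := rfl
    have h1 : weightedHomogeneousComponent (fun i => if i ∈ S then 1 else 0) (m + 1)
        (monomial (0 : Fin n →₀ ℕ) a : MvPolynomial (Fin n) k) = 0 := by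
      rw [ySlice_monomial, if_neg]; simp [blockDeg]
    rw [h1, hC, twist_C]
    simp
  | succ N ih =>
    intro d hd a m hm
    have hne : d ≠ 0 := by rintro rfl; simp at hd
    obtain ⟨i, hi⟩ := Finsupp.support_nonempty_iff.mpr hne
    have hi0 : d i ≠ 0 := Finsupp.mem_support_iff.mp hi
    set d' := d - Finsupp.single i 1 with hd'
    have hdd' : d' + Finsupp.single i 1 = d := Finsupp.sub_add_single_one_cancel hi0
    have hdeg' : d'.degree = N := by
      have := congrArg Finsupp.degree hdd'
      rw [map_add, Finsupp.degree_single, hd] at this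
      omega
    have hmono : (monomial d a : MvPolynomial (Fin n) k) = monomial d' a * X i := by
      rw [X, monomial_mul, mul_one, hdd']
    rw [hmono, map_mul]
    by_cases hiS : i ∈ S
    · have hbd : blockDeg S d' + 1 = blockDeg S d := blockDeg_tsub_single hiS hi
      have hz : weightedHomogeneousComponent (fun i => if i ∈ S then 1 else 0) (m + 1)
          (monomial d' a : MvPolynomial (Fin n) k) = 0 := by
        rw [ySlice_monomial, if_neg (by omega)]
      rw [twist_X_of_mem Ξ hiS, mul_add, map_add, ySlice_mul_of_blockDeg_eq_zero m _ (hΞ i hiS),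
        ih d' hdeg' a m (by omega), hz, ySlice_succ_mul_X_of_mem hiS, sum_mul_pderiv_mul_X_of_mem Ξ hiS]
      simp only [map_zero, mul_zero, Finset.sum_const_zero, add_zero]
      cases m with
      | zero =>
        rw [ySlice_zero_mul_X_of_mem hiS, ySlice_zero_mul_X_of_mem hiS,
          Finset.sum_eq_zero (fun l hl => by rw [pderiv_ySlice_zero hl, mul_zero]), zero_mul, zero_add,
          zero_add]
      | succ m =>
        rw [ySlice_succ_mul_X_of_mem hiS, ySlice_succ_mul_X_of_mem hiS, ih d' hdeg' a m (by omega)]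
        ring
    · have hbd : blockDeg S d' = blockDeg S d := blockDeg_tsub_single_of_not_mem hiS
      rw [twist_X_of_not_mem Ξ hiS, ySlice_mul_X_of_not_mem hiS, ySlice_mul_X_of_not_mem hiS,
        ySlice_mul_X_of_not_mem hiS, ih d' hdeg' a m (by omega), sum_mul_pderiv_mul_X_of_not_mem Ξ hiS,
        add_mul]

/-- **First-order Taylor formula for the `y`-slices of a twist.** For `Ξ ∈ k[U]^S` and `P` all of whose
monomials have `y`-degree `≤ m + 1`: `[twist_Ξ P]_m = [P]_m + Σ_{l ∈ S} Ξ_l · ∂_l [P]_{m+1}`, where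
`[·]_m` is the `y`-degree-`m` slice (`weightedHomogeneousComponent` for the indicator weight of `S`).
(Ours, elementary.) [cite: CossartJannsenSaito2020, Def. 8.13 (pp. 120–121)] -/
theorem weightedHomogeneousComponent_twist_eq (Ξ : Fin n → MvPolynomial (Fin n) k)
    (hΞ : ∀ i ∈ S, ∀ e ∈ (Ξ i).support, blockDeg S e = 0) {P : MvPolynomial (Fin n) k} {m : ℕ}
    (hP : ∀ d ∈ P.support, blockDeg S d ≤ m + 1) :
    weightedHomogeneousComponent (fun i => if i ∈ S then 1 else 0) m (twist S Ξ P) =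
      weightedHomogeneousComponent (fun i => if i ∈ S then 1 else 0) m P +
        ∑ l ∈ S, Ξ l * pderiv l
          (weightedHomogeneousComponent (fun i => if i ∈ S then 1 else 0) (m + 1) P) := by
  classical
  conv_lhs => rw [P.as_sum, map_sum, map_sum]
  conv_rhs => rw [P.as_sum, map_sum, map_sum]
  simp_rw [map_sum, Finset.mul_sum]
  rw [Finset.sum_comm, ← Finset.sum_add_distrib]
  exact Finset.sum_congr rfl fun d hd => ySlice_twist_monomial Ξ hΞ _ d rfl _ m (hP d hd)

/-- Weighted homogeneous components commute with substitutions by weighted homogeneous polynomials of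
the matching weights. [folklore] -/
private theorem weightedHomogeneousComponent_aeval {σ τ : Type*} (w₁ : σ → ℕ) (w₂ : τ → ℕ)
    (g : σ → MvPolynomial τ k) (hg : ∀ v, IsWeightedHomogeneous w₂ (g v) (w₁ v))
    (H : MvPolynomial σ k) (m : ℕ) :
    weightedHomogeneousComponent w₂ m (aeval g H) = aeval g (weightedHomogeneousComponent w₁ m H) := by
  classical
  have hmono : ∀ (d : σ →₀ ℕ) (c : k),
      IsWeightedHomogeneous w₂ (aeval g (monomial d c)) (weight w₁ d) := by
    intro d c
    rw [aeval_monomial, algebraMap_eq, Finsupp.weight_apply, Finsupp.prod, Finsupp.sum,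
      ← zero_add (∑ _ ∈ _, _)]
    exact (isWeightedHomogeneous_C w₂ c).mul
      (IsWeightedHomogeneous.prod d.support (fun v => g v ^ d v) (fun v => d v • w₁ v)
        fun v _ => (hg v).pow (d v))
  conv_lhs => rw [H.as_sum, map_sum, map_sum]
  conv_rhs => rw [H.as_sum, map_sum, map_sum]
  refine Finset.sum_congr rfl fun d _ => ?_
  rw [weightedHomogeneousComponent_of_mem ((mem_weightedHomogeneousSubmodule _ _ _ _).mpr (hmono d _)),
    weightedHomogeneousComponent_of_mem ((mem_weightedHomogeneousSubmodule _ _ _ _).mpr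
      (isWeightedHomogeneous_monomial w₁ d (coeff d H) rfl))]
  split_ifs <;> simp

/-- The weight on `k[X, T]` reading off the `y`-degree (`T` and the `u`-variables have weight `0`).
[folklore] -/
private def wT (S : Finset (Fin n)) : Option (Fin n) → ℕ := fun o => o.elim 0 fun i => if i ∈ S then 1 else 0

/-- `T` has weight `0`. [folklore] -/
@[simp] private theorem wT_none : wT S none = 0 := rfl

/-- `X_i` has weight `1` iff `i ∈ S`. [folklore] -/
@[simp] private theorem wT_some (i : Fin n) : wT S (some i) = if i ∈ S then 1 else 0 := rfl

/-- The inclusion `ι : k[X] → k[X, T]` commutes with the `y`-slices. [folklore] -/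
private theorem rename_ySlice (m : ℕ) (H : MvPolynomial (Fin n) k) :
    rename some (weightedHomogeneousComponent (fun i => if i ∈ S then 1 else 0) m H) =
      weightedHomogeneousComponent (wT S) m (rename some H) := by
  have hre : aeval (fun i => (X (some i) : MvPolynomial (Option (Fin n)) k)) = rename some :=
    MvPolynomial.algHom_ext fun i => by rw [aeval_X, rename_X]
  rw [← hre]
  exact (weightedHomogeneousComponent_aeval (fun i => if i ∈ S then 1 else 0) (wT S) _
    (fun v => isWeightedHomogeneous_X k (wT S) (some v)) H m).symm

/-- For `c` with `c_S = 0` the translation by `c` commutes with the `y`-slices of `k[X, T]`. [folklore] -/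
private theorem translate_ySlice {c : Fin n → k} (hcS : ∀ i ∈ S, c i = 0) (m : ℕ)
    (G : MvPolynomial (Option (Fin n)) k) :
    translate k c (weightedHomogeneousComponent (wT S) m G) =
      weightedHomogeneousComponent (wT S) m (translate k c G) := by
  classical
  have htr : aeval (fun o : Option (Fin n) => o.elim (X none) fun i => X (some i) + C (c i) * X none) =
      translate k c :=
    MvPolynomial.algHom_ext fun o => by cases o <;> simp [translate_X_none, translate_X_some]
  rw [← htr]
  refine (weightedHomogeneousComponent_aeval (wT S) (wT S) _ (fun o => ?_) G m).symm
  cases o with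
  | none => exact isWeightedHomogeneous_X k (wT S) none
  | some i =>
    show IsWeightedHomogeneous (wT S) (X (some i) + C (c i) * X none) (wT S (some i))
    by_cases hi : i ∈ S
    · rw [hcS i hi, C_0, zero_mul, add_zero]
      exact isWeightedHomogeneous_X k (wT S) (some i)
    · have h1 : IsWeightedHomogeneous (wT S) (X (some i) : MvPolynomial (Option (Fin n)) k) 0 := by
        have h := isWeightedHomogeneous_X k (wT S) (some i)
        rwa [wT_some, if_neg hi] at h
      have h2 : IsWeightedHomogeneous (wT S) (C (c i) * X none : MvPolynomial (Option (Fin n)) k) 0 := by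
        have h := (isWeightedHomogeneous_C (wT S) (c i)).mul (isWeightedHomogeneous_X k (wT S) none)
        rwa [wT_none, add_zero] at h
      rw [wT_some, if_neg hi]
      exact h1.add h2

/-- For `c` with `c_S = 0`: `c ∈ 𝕎(G) ⇒ c ∈ 𝕎([G]_m)` for every `y`-slice `[G]_m` (the translation by
`c` preserves the `y`-grading of `k[X, T]`). [folklore] -/
private theorem mem_invarianceSpace_ySlice {c : Fin n → k} (hcS : ∀ i ∈ S, c i = 0)
    {G : MvPolynomial (Fin n) k} (hc : c ∈ invarianceSpace k ({G} : Set (MvPolynomial (Fin n) k)))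
    (m : ℕ) :
    c ∈ invarianceSpace k
      ({weightedHomogeneousComponent (fun i => if i ∈ S then 1 else 0) m G} :
        Set (MvPolynomial (Fin n) k)) := by
  have hG : translate k c (rename some G) = rename some G := (mem_invarianceSpace_iff k).mp hc G rfl
  rw [mem_invarianceSpace_iff]
  simp only [Set.mem_singleton_iff, forall_eq]
  rw [rename_ySlice, translate_ySlice hcS, hG]

end Slices

/-! ## §9 (rev. 2) Coefficient extraction along a set of variables (generic; cf. the parent's private `coeffAlong`) -/

section CoeffAlongGen

variable {σ : Type*} (p : σ → Prop) [DecidablePred p]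

/-- The `p`-part of an exponent. [folklore] -/
private def inPart (d : σ →₀ ℕ) : σ →₀ ℕ := d.filter p

/-- The `¬p`-part of an exponent. [folklore] -/
private def outPart (d : σ →₀ ℕ) : σ →₀ ℕ := d.filter fun i => ¬ p i

/-- `d = d|_p + d|_{¬p}`. [folklore] -/
private theorem inPart_add_outPart (d : σ →₀ ℕ) : inPart p d + outPart p d = d := by
  simp only [inPart, outPart]
  exact Finsupp.filter_add_filter_not d p

/-- Coefficient extraction along `k[X_v : p v]`: `Σ_d c_d X^d ↦ Σ_{d : d|_p = B} c_d X^{d|_{¬p}}`.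
[folklore] -/
private def coeffAlongP [DecidableEq σ] (B : σ →₀ ℕ) : MvPolynomial σ k →ₗ[k] MvPolynomial σ k :=
  Finsupp.lsum k (fun d : σ →₀ ℕ =>
      if inPart p d = B then (monomial (outPart p d) : k →ₗ[k] MvPolynomial σ k) else 0)
    ∘ₗ (AddMonoidAlgebra.coeffLinearEquiv k).toLinearMap

/-- `coeffAlongP` on a monomial. [folklore] -/
private theorem coeffAlongP_monomial [DecidableEq σ] (B d : σ →₀ ℕ) (c : k) :
    coeffAlongP (k := k) p B (monomial d c) =
      if inPart p d = B then monomial (outPart p d) c else 0 := by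
  have : coeffAlongP (k := k) p B (monomial d c) =
      (if inPart p d = B then (monomial (outPart p d) : k →ₗ[k] MvPolynomial σ k) else 0) c :=
    sum_monomial_eq (LinearMap.map_zero _)
  rw [this]
  split_ifs <;> simp

/-- For `D ∈ k[X_v : p v]` and `Φ ∈ k[X_v : ¬ p v]` the `X^B`-coefficient of `D · Φ` along `p` is
`D_B · Φ`. [folklore] -/
private theorem coeffAlongP_mul_of_supported [DecidableEq σ] {D Φ : MvPolynomial σ k}
    (hD : ∀ d ∈ D.support, outPart p d = 0) (hΦ : ∀ d ∈ Φ.support, inPart p d = 0) (B : σ →₀ ℕ) :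
    coeffAlongP p B (D * Φ) = coeff B D • Φ := by
  classical
  conv_lhs => rw [D.as_sum, Φ.as_sum, Finset.sum_mul_sum]
  simp_rw [map_sum]
  have key : ∀ d₁ ∈ D.support, ∀ d₂ ∈ Φ.support,
      coeffAlongP (k := k) p B (monomial d₁ (coeff d₁ D) * monomial d₂ (coeff d₂ Φ)) =
        if d₁ = B then monomial d₂ (coeff d₁ D * coeff d₂ Φ) else 0 := by
    intro d₁ hd₁ d₂ hd₂
    rw [monomial_mul, coeffAlongP_monomial]
    have h1 : inPart p (d₁ + d₂) = d₁ := by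
      have := inPart_add_outPart p d₁
      rw [hD d₁ hd₁, add_zero] at this
      simp only [inPart, Finsupp.filter_add] at this ⊢
      rw [this]; simpa [inPart] using hΦ d₂ hd₂
    have h2 : outPart p (d₁ + d₂) = d₂ := by
      have := inPart_add_outPart p d₂
      rw [hΦ d₂ hd₂, zero_add] at this
      simp only [outPart, Finsupp.filter_add] at this ⊢
      rw [this]
      have h0 := hD d₁ hd₁
      simp only [outPart] at h0
      rw [h0, zero_add]
    rw [h1, h2]
  rw [Finset.sum_congr rfl fun d₁ hd₁ => Finset.sum_congr rfl fun d₂ hd₂ => key d₁ hd₁ d₂ hd₂,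
    Finset.sum_comm]
  simp_rw [Finset.sum_ite_eq' D.support]
  by_cases hB : B ∈ D.support
  · simp_rw [if_pos hB]
    conv_rhs => rw [Φ.as_sum, Finset.smul_sum]
    refine Finset.sum_congr rfl fun d₂ _ => ?_
    rw [smul_monomial, smul_eq_mul]
  · simp_rw [if_neg hB]
    rw [Finset.sum_const_zero, notMem_support_iff.mp hB, zero_smul]

end CoeffAlongGen

/-! ## §10 (rev. 2) The bridge: (N0) + (IND) imply the exhaustion hypothesis -/

section Bridge

variable {f : MvPolynomial (Fin n) k} {ν : ℕ} {S : Finset (Fin n)}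

/-- In `k[X, T]`: if `Σ_l E_l · ι(P_l) = 0` with `(P_l)` a `k`-linearly independent family in `k[X_S]`
and every `E_l` free of the variables `X_S`, then every `E_l` vanishes (coefficient extraction along
`k[T, X_{Sᶜ}]` + linear independence of `ι(P_l)`). [folklore] -/
private theorem eq_zero_of_sum_mul_rename_eq_zero {ι : Type*} [Fintype ι]
    (P : ι → MvPolynomial (Fin n) k) (hP : LinearIndependent k P)
    (hPS : ∀ l, ∀ d ∈ (P l).support, ∀ j ∉ S, d j = 0)
    (E : ι → MvPolynomial (Option (Fin n)) k)
    (hE : ∀ l, ∀ d ∈ (E l).support, ∀ i ∈ S, d (some i) = 0)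
    (h : ∑ l, E l * rename some (P l) = 0) : ∀ l, E l = 0 := by
  classical
  let q : Option (Fin n) → Prop := fun o => ∀ i ∈ S, o ≠ some i
  have hlin : LinearIndependent k fun l => rename some (P l) :=
    hP.map' (rename some : MvPolynomial (Fin n) k →ₐ[k] MvPolynomial (Option (Fin n)) k).toLinearMap
      (LinearMap.ker_eq_bot.mpr (rename_injective _ (Option.some_injective _)))
  intro l₀
  ext B
  rw [coeff_zero]
  have key : ∑ l, coeff B (E l) • rename some (P l) = 0 := by
    have := congrArg (coeffAlongP q B) h
    rw [map_sum, map_zero] at this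
    rw [← this]
    refine Finset.sum_congr rfl fun l _ => (coeffAlongP_mul_of_supported q ?_ ?_ B).symm
    · intro d hd
      ext o
      simp only [outPart, Finsupp.filter_apply, Finsupp.coe_zero, Pi.zero_apply]
      split_ifs with ho
      · rfl
      · have : ∃ i ∈ S, o = some i := by simpa [q] using ho
        obtain ⟨i, hi, rfl⟩ := this
        exact hE l d hd i hi
    · intro d hd
      obtain ⟨u, hu, rfl⟩ : ∃ u ∈ (P l).support, Finsupp.mapDomain some u = d := by
        by_contra hne
        refine (mem_support_iff.mp hd) (coeff_rename_eq_zero _ _ _ fun u hu' => ?_)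
        exact notMem_support_iff.mp fun hu => hne ⟨u, hu, hu'⟩
      ext o
      simp only [inPart, Finsupp.filter_apply, Finsupp.coe_zero, Pi.zero_apply]
      split_ifs with ho
      · cases o with
        | none => exact Finsupp.mapDomain_notin_range _ _ (by simp)
        | some j =>
          rw [Finsupp.mapDomain_apply (Option.some_injective _)]
          exact hPS l u hu j fun hj => ho j hj rfl
      · rfl
  exact Fintype.linearIndependent_iff.mp hlin (fun l => coeff B (E l)) key l₀

/-- For `c` with `c_S = 0` the translation by `c` fixes `ι(k[X_S])`. [folklore] -/
private theorem translate_rename_eq_self_of_forall {c : Fin n → k} (hcS : ∀ i ∈ S, c i = 0)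
    {G : MvPolynomial (Fin n) k} (hG : ∀ d ∈ G.support, ∀ j ∉ S, d j = 0) :
    translate k c (rename some G) = rename some G := by
  have hGs : G ∈ supported k {j : Fin n | j ∈ S} := by
    rw [mem_supported]
    intro x hx
    by_contra hxS
    rw [Finset.mem_coe, mem_vars_iff_mem_support] at hx
    obtain ⟨d, hd, hxd⟩ := hx
    exact (Finsupp.mem_support_iff.mp hxd) (hG d hd x hxS)
  have hle : supported k {j : Fin n | j ∈ S} ≤
      AlgHom.equalizer ((translate k c).comp (rename some)) (rename some) := by
    rw [supported_eq_adjoin_X]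
    refine Algebra.adjoin_le ?_
    rintro _ ⟨j, hj, rfl⟩
    rw [SetLike.mem_coe, AlgHom.mem_equalizer, AlgHom.comp_apply, rename_X, translate_X_some,
      hcS j hj, C_0, zero_mul, add_zero]
  exact (AlgHom.mem_equalizer _ _ _).mp (hle hGs)

/-- The support of `∂_l G` consists of exponents `d − e_l`, `d ∈ supp G`. [folklore] -/
private theorem exists_of_mem_support_pderiv {G : MvPolynomial (Fin n) k} {l : Fin n} {e : Fin n →₀ ℕ}
    (he : e ∈ (pderiv l G).support) : ∃ d ∈ G.support, e = d - Finsupp.single l 1 := by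
  classical
  rw [G.as_sum, map_sum] at he
  simp_rw [pderiv_monomial] at he
  obtain ⟨d, hd, he'⟩ := Finset.mem_biUnion.mp (support_sum he)
  exact ⟨d, hd, Finset.mem_singleton.mp (support_monomial_subset he')⟩

/-- Membership in `k[T, X_{Sᶜ}] ⊆ k[X, T]` read on supports. [folklore] -/
private theorem forall_apply_some_eq_zero_of_mem {G : MvPolynomial (Option (Fin n)) k}
    (hG : G ∈ supported k {o : Option (Fin n) | ∀ i ∈ S, o ≠ some i}) :
    ∀ d ∈ G.support, ∀ i ∈ S, d (some i) = 0 := by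
  intro d hd i hi
  by_contra hne
  have hv : some i ∈ (G.vars : Set (Option (Fin n))) :=
    Finset.mem_coe.mpr ((mem_vars_iff_mem_support (some i)).mpr ⟨d, hd, Finsupp.mem_support_iff.mpr hne⟩)
  exact (mem_supported.mp hG hv) i hi rfl

/-- `ι(k[U]) ⊆ k[T, X_{Sᶜ}]`. [folklore] -/
private theorem rename_mem_supported_of_blockDeg {B : MvPolynomial (Fin n) k}
    (hB : ∀ e ∈ B.support, blockDeg S e = 0) :
    rename some B ∈ supported k {o : Option (Fin n) | ∀ i ∈ S, o ≠ some i} := by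
  have hle : supported k {j : Fin n | j ∉ S} ≤
      (supported k {o : Option (Fin n) | ∀ i ∈ S, o ≠ some i}).comap
        (rename some : MvPolynomial (Fin n) k →ₐ[k] MvPolynomial (Option (Fin n)) k) := by
    rw [supported_eq_adjoin_X]
    refine Algebra.adjoin_le ?_
    rintro _ ⟨j, hj, rfl⟩
    rw [SetLike.mem_coe, Subalgebra.mem_comap, rename_X]
    exact X_mem_supported.mpr fun i hi h => hj (by rw [Option.some_injective _ h]; exact hi)
  exact (Subalgebra.mem_comap _ _ _).mp (hle (mem_supported_of_blockDeg S hB))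

/-- The translation by `c` preserves `k[T, X_{Sᶜ}]`. [folklore] -/
private theorem translate_mem_supported {c : Fin n → k} {G : MvPolynomial (Option (Fin n)) k}
    (hG : G ∈ supported k {o : Option (Fin n) | ∀ i ∈ S, o ≠ some i}) :
    translate k c G ∈ supported k {o : Option (Fin n) | ∀ i ∈ S, o ≠ some i} := by
  have hle : supported k {o : Option (Fin n) | ∀ i ∈ S, o ≠ some i} ≤
      (supported k {o : Option (Fin n) | ∀ i ∈ S, o ≠ some i}).comap (translate k c) := by
    nth_rewrite 1 [supported_eq_adjoin_X]
    refine Algebra.adjoin_le ?_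
    rintro _ ⟨o, ho, rfl⟩
    rw [SetLike.mem_coe, Subalgebra.mem_comap]
    cases o with
    | none => rw [translate_X_none]; exact X_mem_supported.mpr ho
    | some j =>
      rw [translate_X_some, ← smul_eq_C_mul]
      exact add_mem (X_mem_supported.mpr ho)
        (Subalgebra.smul_mem _ (X_mem_supported.mpr
          (show (none : Option (Fin n)) ∈ {o : Option (Fin n) | ∀ i ∈ S, o ≠ some i} from
            fun i _ h => Option.some_ne_none i h.symm)) _)
  exact (Subalgebra.mem_comap _ _ _).mp (hle hG)

/-- **(N0) + (IND) imply the exhaustion hypothesis.** If `f` has no monomials `Y^B U^A` with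
`|B| = ν − 1`, `|A| = δ` (N0) and the partials `∂ in_ν(f)/∂X_l`, `l ∈ S`, are `k`-linearly independent
(IND; `in_ν f ∈ k[X_S]`), then for every `u`-direction `c` (`c_S = 0`) outside `𝕎(in_δ f)` and every
twist `Ξ ∈ k[U]_δ^S`, `c ∉ 𝕎(twist_Ξ in_δ f)` — hypothesis `hcount` of
`hironakaTau_deltaInitial_le_of_forall_twist`. Proof: the `y`-degree-`(ν−1)` slice of `twist_Ξ in_δ f`
is `Σ_l Ξ_l ∂_l in_ν f` (first-order Taylor formula; the slice of `in_δ f` itself vanishes by (N0));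
`c`-invariance of it forces, by coefficient extraction along `k[T, U]` and (IND), the `c`-invariance of
every `Ξ_l`, and then Lemma F (`twist_Ξ` commutes with the translation by `c`) transports
`c ∈ 𝕎(twist_Ξ in_δ f)` back to `c ∈ 𝕎(in_δ f)`. So the count of
`hironakaTau_deltaInitial_le_of_linearIndependent` is the special case (N0)+(IND) of the count by
exhaustion of twists. (Ours, in the model.)
[cite: CossartJannsenSaito2020, Thm. 8.16 (p. 121), Def. 8.13 (pp. 120–121), Def. 8.2 (4) (p. 118); CossartPiltant2008, proof of Prop. 4.2] -/
theorem forall_twist_of_linearIndependent {δ : ℚ}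
    (hFS : ∀ d ∈ (homogeneousComponent ν f).support, ∀ j ∉ S, d j = 0)
    (hN0 : ∀ d ∈ f.support, blockDeg S d + 1 = ν → (coDeg S d : ℚ) ≠ δ)
    (hind : LinearIndependent k fun l : ↥S => pderiv (l : Fin n) (homogeneousComponent ν f)) :
    ∀ c : Fin n → k, (∀ i ∈ S, c i = 0) → c ∉ invarianceSpace k {deltaInitial S ν δ f} →
      ∀ Ξ : Fin n → MvPolynomial (Fin n) k,
        (∀ i ∈ S, ∀ d ∈ (Ξ i).support, blockDeg S d = 0 ∧ (d.degree : ℚ) = δ) →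
        c ∉ invarianceSpace k {twist S Ξ (deltaInitial S ν δ f)} := by
  classical
  intro c hcS hc Ξ hΞ hmem
  apply hc
  have hΞ0 : ∀ i ∈ S, ∀ d ∈ (Ξ i).support, blockDeg S d = 0 := fun i hi d hd => (hΞ i hi d hd).1
  have hΞs : ∀ i ∈ S, Ξ i ∈ supported k {j : Fin n | j ∉ S} := fun i hi =>
    mem_supported_of_blockDeg S (hΞ0 i hi)
  suffices hinvΞ : ∀ i ∈ S, c ∈ invarianceSpace k ({Ξ i} : Set (MvPolynomial (Fin n) k)) from
    (mem_invarianceSpace_twist_iff hcS hΞs hinvΞ _).mp hmem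
  intro l₀ hl₀
  obtain ⟨m, rfl⟩ : ∃ m, ν = m + 1 := by
    cases ν with
    | zero =>
      exfalso
      refine hind.ne_zero ⟨l₀, hl₀⟩ ?_
      simp only [homogeneousComponent_zero, pderiv_C]
    | succ m => exact ⟨m, rfl⟩
  have hDsupp : ∀ d ∈ (deltaInitial S (m + 1) δ f).support, blockDeg S d ≤ m + 1 := by
    intro d hd
    have := mem_support_iff.mp hd
    rw [deltaInitial, coeff_sum_filter_monomial] at this
    by_contra hlt
    exact this (if_neg fun h => hlt h.1)
  have htw : weightedHomogeneousComponent (fun i => if i ∈ S then 1 else 0) m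
      (twist S Ξ (deltaInitial S (m + 1) δ f)) =
        ∑ l ∈ S, Ξ l * pderiv l (homogeneousComponent (m + 1) f) := by
    rw [weightedHomogeneousComponent_twist_eq Ξ hΞ0 hDsupp,
      weightedHomogeneousComponent_indicator_deltaInitial_eq_zero hN0,
      weightedHomogeneousComponent_indicator_deltaInitial_eq hFS, zero_add]
  have hinv := mem_invarianceSpace_ySlice hcS hmem m
  rw [htw] at hinv
  have hEq := (mem_invarianceSpace_iff k).mp hinv _ rfl
  have hPS : ∀ l ∈ S, ∀ d ∈ (pderiv l (homogeneousComponent (m + 1) f)).support, ∀ j ∉ S, d j = 0 := by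
    intro l hl d hd j hj
    obtain ⟨e, he, rfl⟩ := exists_of_mem_support_pderiv hd
    rw [Finsupp.tsub_apply, hFS e he j hj, Nat.zero_sub]
  simp only [map_sum, map_mul] at hEq
  rw [Finset.sum_congr rfl fun l hl => by rw [translate_rename_eq_self_of_forall hcS (hPS l hl)]] at hEq
  have hzero : ∑ l : ↥S, (translate k c (rename some (Ξ l)) - rename some (Ξ l)) *
      rename some (pderiv (l : Fin n) (homogeneousComponent (m + 1) f)) = 0 := by
    rw [Finset.sum_coe_sort S (fun l => (translate k c (rename some (Ξ l)) - rename some (Ξ l)) *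
      rename some (pderiv l (homogeneousComponent (m + 1) f)))]
    simp_rw [sub_mul]
    rw [Finset.sum_sub_distrib, sub_eq_zero]
    exact hEq
  have hE := eq_zero_of_sum_mul_rename_eq_zero (S := S)
    (fun l : ↥S => pderiv (l : Fin n) (homogeneousComponent (m + 1) f)) hind (fun l => hPS l l.2)
    (fun l : ↥S => translate k c (rename some (Ξ l)) - rename some (Ξ l))
    (fun l => forall_apply_some_eq_zero_of_mem (sub_mem
      (translate_mem_supported (rename_mem_supported_of_blockDeg (hΞ0 l l.2)))
      (rename_mem_supported_of_blockDeg (hΞ0 l l.2))))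
    hzero ⟨l₀, hl₀⟩
  rw [mem_invarianceSpace_iff]
  simp only [Set.mem_singleton_iff, forall_eq]
  exact sub_eq_zero.mp hE

/-- **The (N0)+(IND) count as a case of the count by exhaustion of twists.** The parent's
`hironakaTau_deltaInitial_le_of_linearIndependent` re-derived through
`hironakaTau_deltaInitial_le_of_forall_twist` and `forall_twist_of_linearIndependent`: for `(f; y; u)`
`δ`-prepared with (N0) and (IND), every centre `(Ψ; γ)` of the prefix class has
`τ(in_δ f) ≤ |S| + #{j ∉ S : γ_j = 1/(νδ)}`. (Ours, in the model.)
[cite: CossartJannsenSaito2020, Thm. 8.16 (p. 121), Def. 8.2 (4) (p. 118), Def. 8.13 (pp. 120–121); AbramovichTemkinWlodarczyk2024, Thm. 5.3.1 (p. 1578); AbramovichQuekSchober2025, Thm. 3.5] -/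
theorem hironakaTau_deltaInitial_le_of_linearIndependent_of_forall_twist
    (hord : monomialOrd (fun _ => 1) f = ν)
    (hτ : S.card = hironakaTau k {homogeneousComponent ν f})
    (hFS : ∀ d ∈ (homogeneousComponent ν f).support, ∀ j ∉ S, d j = 0)
    (hprep : IsDeltaPrepared S ν f) {δ : ℚ} (hδ : hironakaDelta S ν f = δ)
    (hN0 : ∀ d ∈ f.support, blockDeg S d + 1 = ν → (coDeg S d : ℚ) ≠ δ)
    (hind : LinearIndependent k fun l : ↥S => pderiv (l : Fin n) (homogeneousComponent ν f))
    {Ψ : MvPolynomial (Fin n) k ≃ₐ[k] MvPolynomial (Fin n) k} {γ : Fin n → ℚ}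
    (h : IsCentreFor f Ψ γ) (hγS : ∀ i ∈ S, γ i = (ν : ℚ)⁻¹)
    (hγle : ∀ j ∉ S, γ j ≤ ((ν : ℚ) * δ)⁻¹) :
    hironakaTau k {deltaInitial S ν δ f} ≤
      S.card + (Finset.univ.filter (fun j => j ∉ S ∧ γ j = ((ν : ℚ) * δ)⁻¹)).card :=
  hironakaTau_deltaInitial_le_of_forall_twist hord hτ hFS hprep hδ
    (forall_twist_of_linearIndependent hFS hN0 hind) h hγS hγle

/-- **The hand-over under (N0)+(IND).** For `(f; y; u)` `δ`-prepared with (N0) and (IND), a centre of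
the prefix class attaining the count has `T(Ψ, γ) = T(in_δ f)`: the `y`-variables and the weight-`1/(νδ)`
linear parts `ℓ_j` span exactly the directrix of the `δ`-face — new even for the parent's normalised
classes, obtained from `directrix_deltaInitial_eq_competitorSpan_of_forall_twist` through the bridge.
(Ours, in the model.)
[cite: CossartJannsenSaito2020, Thm. 8.16 (p. 121), Def. 8.2 (4) (p. 118), Def. 8.13 (pp. 120–121); CossartPiltant2008, proof of Prop. 4.2; AbramovichTemkinWlodarczyk2024, Thm. 5.3.1 (p. 1578)] -/
theorem directrix_deltaInitial_eq_competitorSpan_of_linearIndependent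
    (hord : monomialOrd (fun _ => 1) f = ν)
    (hτ : S.card = hironakaTau k {homogeneousComponent ν f})
    (hFS : ∀ d ∈ (homogeneousComponent ν f).support, ∀ j ∉ S, d j = 0)
    (hprep : IsDeltaPrepared S ν f) {δ : ℚ} (hδ : hironakaDelta S ν f = δ)
    (hN0 : ∀ d ∈ f.support, blockDeg S d + 1 = ν → (coDeg S d : ℚ) ≠ δ)
    (hind : LinearIndependent k fun l : ↥S => pderiv (l : Fin n) (homogeneousComponent ν f))
    {Ψ : MvPolynomial (Fin n) k ≃ₐ[k] MvPolynomial (Fin n) k} {γ : Fin n → ℚ}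
    (h : IsCentreFor f Ψ γ) (hγS : ∀ i ∈ S, γ i = (ν : ℚ)⁻¹)
    (hγle : ∀ j ∉ S, γ j ≤ ((ν : ℚ) * δ)⁻¹)
    (hattain : S.card + (Finset.univ.filter (fun j => j ∉ S ∧ γ j = ((ν : ℚ) * δ)⁻¹)).card ≤
      hironakaTau k {deltaInitial S ν δ f}) :
    directrix k {deltaInitial S ν δ f} = competitorSpan S ν δ Ψ γ :=
  directrix_deltaInitial_eq_competitorSpan_of_forall_twist hord hτ hFS hprep hδ
    (forall_twist_of_linearIndependent hFS hN0 hind) h hγS hγle hattain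

end Bridge

/-! ## §11 (rev. 3) The bridge for Hironaka-normalised faces: (N0_W) + (IND) imply the exhaustion hypothesis -/

section BridgeW

variable {f : MvPolynomial (Fin n) k} {ν : ℕ} {S : Finset (Fin n)}

/-- A polynomial of `k[T, X_{Sᶜ}]` has exponents with zero `X_S`-part (for the out-predicate
`q o := ∀ i ∈ S, o ≠ some i`). [folklore] -/
private theorem outPart_eq_zero_of_forall {G : MvPolynomial (Option (Fin n)) k}
    (hG : ∀ d ∈ G.support, ∀ i ∈ S, d (some i) = 0) :
    ∀ d ∈ G.support, outPart (fun o : Option (Fin n) => ∀ i ∈ S, o ≠ some i) d = 0 := by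
  classical
  intro d hd
  ext o
  simp only [outPart, Finsupp.filter_apply, Finsupp.coe_zero, Pi.zero_apply]
  split_ifs with ho
  · rfl
  · have : ∃ i ∈ S, o = some i := by simpa using ho
    obtain ⟨i, hi, rfl⟩ := this
    exact hG d hd i hi

/-- `ι(k[X_S])` has exponents with zero out-part. [folklore] -/
private theorem inPart_eq_zero_of_forall {G : MvPolynomial (Fin n) k}
    (hG : ∀ d ∈ G.support, ∀ j ∉ S, d j = 0) :
    ∀ d ∈ (rename some G : MvPolynomial (Option (Fin n)) k).support,
      inPart (fun o : Option (Fin n) => ∀ i ∈ S, o ≠ some i) d = 0 := by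
  classical
  intro d hd
  obtain ⟨u, hu, rfl⟩ : ∃ u ∈ G.support, Finsupp.mapDomain some u = d := by
    by_contra hne
    refine (mem_support_iff.mp hd) (coeff_rename_eq_zero _ _ _ fun u hu' => ?_)
    exact notMem_support_iff.mp fun hu => hne ⟨u, hu, hu'⟩
  ext o
  simp only [inPart, Finsupp.filter_apply, Finsupp.coe_zero, Pi.zero_apply]
  split_ifs with ho
  · cases o with
    | none => exact Finsupp.mapDomain_notin_range _ _ (by simp)
    | some j =>
      rw [Finsupp.mapDomain_apply (Option.some_injective _)]
      exact hG u hu j fun hj => ho j hj rfl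
  · rfl

/-- **Coefficient extraction along `k[T, U]`, with a transversal family.** If `P_l, N_e ∈ k[X_S]` are
such that `Σ a_l P_l + Σ b_e N_e = 0` forces `a = 0` (the `P_l` independent and their span meeting the
span of the `N_e` in `0`), then `Σ_l E_l · ι(P_l) + Σ_e A_e · ι(N_e) = 0` with `E_l, A_e ∈ k[T, X_{Sᶜ}]`
forces every `E_l = 0` (`k[X, T]` is free over `k[T, X_{Sᶜ}]` on the `X_S`-monomials). [folklore] -/
private theorem eq_zero_of_sum_mul_rename_add_eq_zero {ι κ : Type*} [Fintype ι] [Fintype κ]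
    (P : ι → MvPolynomial (Fin n) k) (Nf : κ → MvPolynomial (Fin n) k)
    (hPN : ∀ a : ι → k, ∀ b : κ → k, ∑ l, a l • P l + ∑ e, b e • Nf e = 0 → ∀ l, a l = 0)
    (hPS : ∀ l, ∀ d ∈ (P l).support, ∀ j ∉ S, d j = 0)
    (hNS : ∀ e, ∀ d ∈ (Nf e).support, ∀ j ∉ S, d j = 0)
    (E : ι → MvPolynomial (Option (Fin n)) k) (A : κ → MvPolynomial (Option (Fin n)) k)
    (hE : ∀ l, ∀ d ∈ (E l).support, ∀ i ∈ S, d (some i) = 0)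
    (hA : ∀ e, ∀ d ∈ (A e).support, ∀ i ∈ S, d (some i) = 0)
    (h : ∑ l, E l * rename some (P l) + ∑ e, A e * rename some (Nf e) = 0) : ∀ l, E l = 0 := by
  classical
  let q : Option (Fin n) → Prop := fun o => ∀ i ∈ S, o ≠ some i
  intro l₀
  ext B
  rw [coeff_zero]
  have key : ∑ l, coeff B (E l) • rename some (P l) + ∑ e, coeff B (A e) • rename some (Nf e) =
      (0 : MvPolynomial (Option (Fin n)) k) := by
    have := congrArg (coeffAlongP q B) h
    rw [map_add, map_sum, map_sum, map_zero] at this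
    rw [← this]
    congr 1
    · exact Finset.sum_congr rfl fun l _ => (coeffAlongP_mul_of_supported q
        (outPart_eq_zero_of_forall (hE l)) (inPart_eq_zero_of_forall (hPS l)) B).symm
    · exact Finset.sum_congr rfl fun e _ => (coeffAlongP_mul_of_supported q
        (outPart_eq_zero_of_forall (hA e)) (inPart_eq_zero_of_forall (hNS e)) B).symm
  have key' : rename some (∑ l, coeff B (E l) • P l + ∑ e, coeff B (A e) • Nf e) =
      (rename some 0 : MvPolynomial (Option (Fin n)) k) := by
    rw [map_add, map_sum, map_sum, map_zero]
    simp_rw [map_smul]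
    exact key
  exact hPN _ _ (rename_injective _ (Option.some_injective _) key') l₀

/-- `N_e ∈ k[X_S]` (exponentwise). [folklore] -/
private theorem predFaceSlice_apply_eq_zero {δ : ℚ} (e : Fin n →₀ ℕ) :
    ∀ d ∈ (predFaceSlice S ν δ f e).support, ∀ j ∉ S, d j = 0 := by
  classical
  intro d hd j hj
  rw [predFaceSlice] at hd
  obtain ⟨d', -, hd'⟩ := Finset.mem_biUnion.mp (support_sum hd)
  rw [Finset.mem_singleton.mp (support_monomial_subset hd'), Finsupp.filter_apply, if_neg hj]

/-- `N = Σ_e U^e · N_e`: the `y`-degree-`(ν−1)` slice of the `δ`-face through the slices `N_e`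
(`predFaceSlice`), summed over the `u`-exponents that occur. [folklore] -/
private theorem ySlice_deltaInitial_eq_sum_predFaceSlice {m : ℕ} {δ : ℚ} :
    weightedHomogeneousComponent (fun i => if i ∈ S then 1 else 0) m (deltaInitial S (m + 1) δ f) =
      ∑ e ∈ (f.support.filter fun d => blockDeg S d + 1 = m + 1 ∧ (coDeg S d : ℚ) = δ).image (coPart S),
        monomial e (1 : k) * predFaceSlice S (m + 1) δ f e := by
  classical
  set P := f.support.filter fun d => blockDeg S d + 1 = m + 1 ∧ (coDeg S d : ℚ) = δ with hP
  rw [weightedHomogeneousComponent_indicator_deltaInitial_eq_sum,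
    ← Finset.sum_fiberwise_of_maps_to (s := P) (t := P.image (coPart S)) (g := coPart S)
      (fun d hd => Finset.mem_image_of_mem _ hd)]
  refine Finset.sum_congr rfl fun e _ => ?_
  have hfilter : (f.support.filter fun d =>
      (blockDeg S d + 1 = m + 1 ∧ (coDeg S d : ℚ) = δ) ∧ coPart S d = e) =
      P.filter fun d => coPart S d = e := by
    ext d
    simp only [hP, Finset.mem_filter, and_assoc]
  rw [predFaceSlice, hfilter, Finset.mul_sum]
  refine Finset.sum_congr rfl fun d hd => ?_
  rw [monomial_mul, one_mul, ← (Finset.mem_filter.mp hd).2, coPart, add_comm,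
    Finsupp.filter_add_filter_not]

/-- **The bridge for Hironaka-normalised faces: (N0_W) + (IND) imply the exhaustion hypothesis.**
Let `in_ν f ∈ k[X_S]`, (IND) the partials `∂_l in_ν f` (`l ∈ S`) be linearly independent, and (N0_W)
the slices `N_e ∈ k[X_S]_{ν−1}` of the `y`-degree-`(ν−1)` part `N = Σ_e N_e U^e` of the `δ`-face
(`predFaceSlice`) span a space meeting `span_k {∂_l in_ν f}` only in `0` (the companion file's
hypothesis; it contains (N0)).  Then for every `c` with `c_S = 0`, `c ∉ 𝕎(in_δ f)`, and every twist
`Ξ ∈ k[U]_δ^S`: `c ∉ 𝕎(twist_Ξ in_δ f)`.  Proof: as for `forall_twist_of_linearIndependent`, the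
`y`-degree-`(ν−1)` slice of `twist_Ξ in_δ f` is now `N + Σ_l Ξ_l ∂_l in_ν f`
(`weightedHomogeneousComponent_twist_eq`); its `c`-invariance reads
`Σ_e (τ_c U^e − U^e)·ι(N_e) + Σ_l (τ_c Ξ_l − Ξ_l)·ι(∂_l in_ν f) = 0` in `k[X, T]` with coefficients in
`k[T, U]`, and coefficient extraction along `k[T, U]` with (IND) + (N0_W) gives `τ_c Ξ_l = Ξ_l`;
Lemma F concludes.  So the companion's count `hironakaTau_deltaInitial_le_of_disjoint` is the case
(N0_W)+(IND) of the count by exhaustion, `hironakaTau_deltaInitial_le_of_disjoint_of_forall_twist`.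
(Ours, in the model.)
[cite: CossartJannsenSaito2020, Thm. 8.16 (p. 121), Def. 8.13 (pp. 120–121), Def. 8.2 (4) (p. 118), Thm. 8.22 (a) (p. 124); CossartPiltant2008, proof of Prop. 4.2] -/
theorem forall_twist_of_disjoint {δ : ℚ}
    (hFS : ∀ d ∈ (homogeneousComponent ν f).support, ∀ j ∉ S, d j = 0)
    (hind : LinearIndependent k fun l : ↥S => pderiv (l : Fin n) (homogeneousComponent ν f))
    (hN : Disjoint
      (Submodule.span k (Set.range fun l : ↥S => pderiv (l : Fin n) (homogeneousComponent ν f)))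
      (Submodule.span k (Set.range (predFaceSlice S ν δ f)))) :
    ∀ c : Fin n → k, (∀ i ∈ S, c i = 0) → c ∉ invarianceSpace k {deltaInitial S ν δ f} →
      ∀ Ξ : Fin n → MvPolynomial (Fin n) k,
        (∀ i ∈ S, ∀ d ∈ (Ξ i).support, blockDeg S d = 0 ∧ (d.degree : ℚ) = δ) →
        c ∉ invarianceSpace k {twist S Ξ (deltaInitial S ν δ f)} := by
  classical
  intro c hcS hc Ξ hΞ hmem
  apply hc
  have hΞ0 : ∀ i ∈ S, ∀ d ∈ (Ξ i).support, blockDeg S d = 0 := fun i hi d hd => (hΞ i hi d hd).1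
  have hΞs : ∀ i ∈ S, Ξ i ∈ supported k {j : Fin n | j ∉ S} := fun i hi =>
    mem_supported_of_blockDeg S (hΞ0 i hi)
  suffices hinvΞ : ∀ i ∈ S, c ∈ invarianceSpace k ({Ξ i} : Set (MvPolynomial (Fin n) k)) from
    (mem_invarianceSpace_twist_iff hcS hΞs hinvΞ _).mp hmem
  intro l₀ hl₀
  obtain ⟨m, rfl⟩ : ∃ m, ν = m + 1 := by
    cases ν with
    | zero =>
      exfalso
      refine hind.ne_zero ⟨l₀, hl₀⟩ ?_
      simp only [homogeneousComponent_zero, pderiv_C]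
    | succ m => exact ⟨m, rfl⟩
  have hDsupp : ∀ d ∈ (deltaInitial S (m + 1) δ f).support, blockDeg S d ≤ m + 1 := by
    intro d hd
    have := mem_support_iff.mp hd
    rw [deltaInitial, coeff_sum_filter_monomial] at this
    by_contra hlt
    exact this (if_neg fun h => hlt h.1)
  set F := homogeneousComponent (m + 1) f with hFdef
  set T := (f.support.filter fun d => blockDeg S d + 1 = m + 1 ∧ (coDeg S d : ℚ) = δ).image (coPart S)
    with hT
  have htw : weightedHomogeneousComponent (fun i => if i ∈ S then 1 else 0) m
      (twist S Ξ (deltaInitial S (m + 1) δ f)) =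
        (∑ e ∈ T, monomial e (1 : k) * predFaceSlice S (m + 1) δ f e) +
          ∑ l ∈ S, Ξ l * pderiv l F := by
    rw [weightedHomogeneousComponent_twist_eq Ξ hΞ0 hDsupp, ySlice_deltaInitial_eq_sum_predFaceSlice,
      weightedHomogeneousComponent_indicator_deltaInitial_eq hFS]
  have hinv := mem_invarianceSpace_ySlice hcS hmem m
  rw [htw] at hinv
  have hEq := (mem_invarianceSpace_iff k).mp hinv _ rfl
  have hPS : ∀ l ∈ S, ∀ d ∈ (pderiv l F).support, ∀ j ∉ S, d j = 0 := by
    intro l hl d hd j hj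
    obtain ⟨e, he, rfl⟩ := exists_of_mem_support_pderiv hd
    rw [Finsupp.tsub_apply, hFS e he j hj, Nat.zero_sub]
  simp only [map_add, map_sum, map_mul] at hEq
  have hT1 : ∑ e ∈ T, translate k c (rename some (monomial e (1 : k))) *
      translate k c (rename some (predFaceSlice S (m + 1) δ f e)) =
      ∑ e ∈ T, translate k c (rename some (monomial e (1 : k))) *
        rename some (predFaceSlice S (m + 1) δ f e) :=
    Finset.sum_congr rfl fun (e : Fin n →₀ ℕ) _ => by
      rw [translate_rename_eq_self_of_forall hcS (predFaceSlice_apply_eq_zero (S := S) e)]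
  have hS1 : ∑ l ∈ S, translate k c (rename some (Ξ l)) * translate k c (rename some (pderiv l F)) =
      ∑ l ∈ S, translate k c (rename some (Ξ l)) * rename some (pderiv l F) :=
    Finset.sum_congr rfl fun (l : Fin n) hl => by
      rw [translate_rename_eq_self_of_forall hcS (hPS l hl)]
  rw [hT1, hS1] at hEq
  have hzero : (∑ l : ↥S, (translate k c (rename some (Ξ l)) - rename some (Ξ l)) *
        rename some (pderiv (l : Fin n) F)) +
      ∑ e : ↥T, (translate k c (rename some (monomial (e : Fin n →₀ ℕ) (1 : k))) -
          rename some (monomial (e : Fin n →₀ ℕ) (1 : k))) *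
        rename some (predFaceSlice S (m + 1) δ f e) = 0 := by
    rw [Finset.sum_coe_sort S (fun l => (translate k c (rename some (Ξ l)) - rename some (Ξ l)) *
        rename some (pderiv l F)),
      Finset.sum_coe_sort T (fun e => (translate k c (rename some (monomial e (1 : k))) -
        rename some (monomial e (1 : k))) * rename some (predFaceSlice S (m + 1) δ f e))]
    simp_rw [sub_mul]
    rw [Finset.sum_sub_distrib, Finset.sum_sub_distrib]
    linear_combination hEq
  have hTe : ∀ e ∈ T, blockDeg S e = 0 := by
    intro e he
    obtain ⟨d, -, rfl⟩ := Finset.mem_image.mp he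
    rw [blockDeg_eq_zero_iff]
    intro i hi
    rw [coPart, Finsupp.filter_apply, if_neg (not_not.mpr hi)]
  have hmono : ∀ e ∈ T, ∀ d ∈ (monomial e (1 : k) : MvPolynomial (Fin n) k).support, blockDeg S d = 0 := by
    intro e he d hd
    rw [Finset.mem_singleton.mp (support_monomial_subset hd)]
    exact hTe e he
  have hPN : ∀ a : ↥S → k, ∀ b : ↥T → k,
      ∑ l, a l • pderiv (l : Fin n) F + ∑ e, b e • predFaceSlice S (m + 1) δ f e = 0 →
        ∀ l, a l = 0 := by
    intro a b hab
    have h1 : ∑ l, a l • pderiv (l : Fin n) F ∈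
        Submodule.span k (Set.range fun l : ↥S => pderiv (l : Fin n) F) :=
      Submodule.sum_mem _ fun l _ => Submodule.smul_mem _ _ (Submodule.subset_span ⟨l, rfl⟩)
    have h2 : ∑ l, a l • pderiv (l : Fin n) F ∈
        Submodule.span k (Set.range (predFaceSlice S (m + 1) δ f)) := by
      rw [eq_neg_of_add_eq_zero_left hab]
      exact Submodule.neg_mem _ (Submodule.sum_mem _ fun e _ =>
        Submodule.smul_mem _ _ (Submodule.subset_span ⟨(e : Fin n →₀ ℕ), rfl⟩))
    exact Fintype.linearIndependent_iff.mp hind a ((Submodule.disjoint_def.mp hN) _ h1 h2)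
  have hE := eq_zero_of_sum_mul_rename_add_eq_zero (S := S)
    (fun l : ↥S => pderiv (l : Fin n) F) (fun e : ↥T => predFaceSlice S (m + 1) δ f e) hPN
    (fun l => hPS l l.2) (fun e => predFaceSlice_apply_eq_zero (S := S) (e : Fin n →₀ ℕ))
    (fun l : ↥S => translate k c (rename some (Ξ l)) - rename some (Ξ l))
    (fun e : ↥T => translate k c (rename some (monomial (e : Fin n →₀ ℕ) (1 : k))) -
      rename some (monomial (e : Fin n →₀ ℕ) (1 : k)))
    (fun l => forall_apply_some_eq_zero_of_mem (sub_mem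
      (translate_mem_supported (rename_mem_supported_of_blockDeg (hΞ0 l l.2)))
      (rename_mem_supported_of_blockDeg (hΞ0 l l.2))))
    (fun e => forall_apply_some_eq_zero_of_mem (sub_mem
      (translate_mem_supported (rename_mem_supported_of_blockDeg (hmono e e.2)))
      (rename_mem_supported_of_blockDeg (hmono e e.2))))
    hzero ⟨l₀, hl₀⟩
  rw [mem_invarianceSpace_iff]
  simp only [Set.mem_singleton_iff, forall_eq]
  exact sub_eq_zero.mp hE

/-- **The (N0_W)+(IND) count as a case of the count by exhaustion of twists.** The companion's
`hironakaTau_deltaInitial_le_of_disjoint` (WeightedCentreVertexPreparationNormalised) re-derived through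
`hironakaTau_deltaInitial_le_of_forall_twist` and `forall_twist_of_disjoint`: for `(f; y; u)` `δ`-prepared
with (IND) and (N0_W), every centre `(Ψ; γ)` of the prefix class has `τ(in_δ f) ≤ |S| + #{j ∉ S : γ_j = 1/(νδ)}`.
(Ours, in the model.)
[cite: CossartJannsenSaito2020, Thm. 8.16 (p. 121), Def. 8.2 (4) (p. 118), Def. 8.13 (pp. 120–121), Thm. 8.22 (a) (p. 124); AbramovichTemkinWlodarczyk2024, Thm. 5.3.1 (p. 1578); AbramovichQuekSchober2025, Thm. 3.5] -/
theorem hironakaTau_deltaInitial_le_of_disjoint_of_forall_twist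
    (hord : monomialOrd (fun _ => 1) f = ν)
    (hτ : S.card = hironakaTau k {homogeneousComponent ν f})
    (hFS : ∀ d ∈ (homogeneousComponent ν f).support, ∀ j ∉ S, d j = 0)
    (hprep : IsDeltaPrepared S ν f) {δ : ℚ} (hδ : hironakaDelta S ν f = δ)
    (hind : LinearIndependent k fun l : ↥S => pderiv (l : Fin n) (homogeneousComponent ν f))
    (hN : Disjoint
      (Submodule.span k (Set.range fun l : ↥S => pderiv (l : Fin n) (homogeneousComponent ν f)))
      (Submodule.span k (Set.range (predFaceSlice S ν δ f))))
    {Ψ : MvPolynomial (Fin n) k ≃ₐ[k] MvPolynomial (Fin n) k} {γ : Fin n → ℚ}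
    (h : IsCentreFor f Ψ γ) (hγS : ∀ i ∈ S, γ i = (ν : ℚ)⁻¹)
    (hγle : ∀ j ∉ S, γ j ≤ ((ν : ℚ) * δ)⁻¹) :
    hironakaTau k {deltaInitial S ν δ f} ≤
      S.card + (Finset.univ.filter (fun j => j ∉ S ∧ γ j = ((ν : ℚ) * δ)⁻¹)).card :=
  hironakaTau_deltaInitial_le_of_forall_twist hord hτ hFS hprep hδ
    (forall_twist_of_disjoint hFS hind hN) h hγS hγle

/-- **The hand-over under (N0_W)+(IND).** For `(f; y; u)` `δ`-prepared with (IND) and (N0_W), a centre of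
the prefix class attaining the count has `T(Ψ, γ) = T(in_δ f)` — from
`directrix_deltaInitial_eq_competitorSpan_of_forall_twist` through the bridge `forall_twist_of_disjoint`.
(Ours, in the model.)
[cite: CossartJannsenSaito2020, Thm. 8.16 (p. 121), Def. 8.2 (4) (p. 118), Def. 8.13 (pp. 120–121), Thm. 8.22 (a) (p. 124); CossartPiltant2008, proof of Prop. 4.2; AbramovichTemkinWlodarczyk2024, Thm. 5.3.1 (p. 1578)] -/
theorem directrix_deltaInitial_eq_competitorSpan_of_disjoint
    (hord : monomialOrd (fun _ => 1) f = ν)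
    (hτ : S.card = hironakaTau k {homogeneousComponent ν f})
    (hFS : ∀ d ∈ (homogeneousComponent ν f).support, ∀ j ∉ S, d j = 0)
    (hprep : IsDeltaPrepared S ν f) {δ : ℚ} (hδ : hironakaDelta S ν f = δ)
    (hind : LinearIndependent k fun l : ↥S => pderiv (l : Fin n) (homogeneousComponent ν f))
    (hN : Disjoint
      (Submodule.span k (Set.range fun l : ↥S => pderiv (l : Fin n) (homogeneousComponent ν f)))
      (Submodule.span k (Set.range (predFaceSlice S ν δ f))))
    {Ψ : MvPolynomial (Fin n) k ≃ₐ[k] MvPolynomial (Fin n) k} {γ : Fin n → ℚ}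
    (h : IsCentreFor f Ψ γ) (hγS : ∀ i ∈ S, γ i = (ν : ℚ)⁻¹)
    (hγle : ∀ j ∉ S, γ j ≤ ((ν : ℚ) * δ)⁻¹)
    (hattain : S.card + (Finset.univ.filter (fun j => j ∉ S ∧ γ j = ((ν : ℚ) * δ)⁻¹)).card ≤
      hironakaTau k {deltaInitial S ν δ f}) :
    directrix k {deltaInitial S ν δ f} = competitorSpan S ν δ Ψ γ :=
  directrix_deltaInitial_eq_competitorSpan_of_forall_twist hord hτ hFS hprep hδ
    (forall_twist_of_disjoint hFS hind hN) h hγS hγle hattain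

/-- (N0) ⇒ (N0_W) (`disjoint_span_pderiv_predFaceSlice_of_forall_ne`), so `forall_twist_of_linearIndependent`
is also the case `N = 0` of `forall_twist_of_disjoint` (its direct proof in §10 is kept). [folklore] -/
example {δ : ℚ} (hFS : ∀ d ∈ (homogeneousComponent ν f).support, ∀ j ∉ S, d j = 0)
    (hN0 : ∀ d ∈ f.support, blockDeg S d + 1 = ν → (coDeg S d : ℚ) ≠ δ)
    (hind : LinearIndependent k fun l : ↥S => pderiv (l : Fin n) (homogeneousComponent ν f)) :
    ∀ c : Fin n → k, (∀ i ∈ S, c i = 0) → c ∉ invarianceSpace k {deltaInitial S ν δ f} →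
      ∀ Ξ : Fin n → MvPolynomial (Fin n) k,
        (∀ i ∈ S, ∀ d ∈ (Ξ i).support, blockDeg S d = 0 ∧ (d.degree : ℚ) = δ) →
        c ∉ invarianceSpace k {twist S Ξ (deltaInitial S ν δ f)} :=
  forall_twist_of_disjoint hFS hind (disjoint_span_pderiv_predFaceSlice_of_forall_ne hN0)

end BridgeW

end WeightedBlowup

end Literature.AlgebraicGeometry.Resolution
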